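import Literature.MathematicalPhysics.QuantumFieldTheory.Balaban1983to89.TreeLength

/-!
# `Balaban1983to89.B12EdgeTreeLength257` — [Balaban1987RG1] p. 257, the «equivalent definition» of the linear size
d_j(X) by tree graphs formed by EDGES OF CUBES: the edge length `edgeLen X`, its comparison with `TreeLength.treeLen X`
(equivalent UP TO CONSTANTS — proved), and a kernel witness that the two lengths DIFFER for the length functional of
record (the 3^d block, every d ≥ 2)

statement-level skeleton of published theorems with citation tags; proofs where landed; nothing here is a claim about
the Yang–Mills mass gap

CITATION HEADER (lean-in-tree rule 2026-08-18).  Source under audit: T. Bałaban, *Renormalization group approach to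
lattice gauge field theories. I. Generation of effective actions in a small field approximation and a coupling
constant renormalization in four dimensions*, Commun. Math. Phys. **109**, 249–301 (1987) [Balaban1987RG1] (cell paper
B12 = "[I]"; held `paper:balaban1987-cmp109-rg-i-small-field`, journal page = PDF page + 248; p. 257 = PDF p. 9, read on
the text layer `p0009.txt` and on the render `…/1987-cmp109-rg-I-small-field/…-p009-x2.png`).  Satellite of
`…Balaban1983to89.TreeLength` (unit b2b-balaban-pv22: the continuum linear size `treeLen`, sup metric of
[Dimock2013BalabanII] App. E — its header lists the present sentence under «(iii) … NOT reproduced») and of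
`…Balaban1983to89.B13ScaleTransfer` (index model `Pt`, `Adj`, `FaceConnected`, the 3^d block `block`); nothing existing
is modified.  Cell records: ROWS-B12 (r09) row B12.Note@257; DIVERGENCE D-T2 (the print names no metric for the length
of a graph); GAPS.md G-B12-08 (this file's §6).  Unit `lit-balaban-r09` gen 14 (reader/typer r09, display owner of B12).

WHAT THE PAPER PRINTS (p. 257, verbatim).  *"Thus every localization domain X is a union of continuous space cubes from
π_j. Consider a class of tree graphs contained in X and intersecting all the cubes in X. A length of a shortest graph
in this class, divided by M, is the linear size of X, and is denoted by d_j(X). Thus we rescale the space, so that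
cubes from π_j become unit cubes, and we take the distance in this scale. Let us stress the fact that we consider
graphs in the continuous space. For a given X usually there are many of these shortest tree graphs. It is easy to see
that there are also the shortest tree graphs formed by edges of cubes in X, hence an equivalent definition can be
formulated, based on such graphs only."*

WHAT IS FORMALISED HERE (kernel-checked, over the objects of `…TreeLength`: unit cubes `cube x`, x ∈ ℤ^d, polygonal
graphs = lists of segments with `carrier`/`len` (SUP METRIC), `Admissible X T`, `treeLen X`).
* §1 — EDGE GRAPHS («tree graphs formed by edges of cubes in X»): finite lists `E` of LATTICE PAIRS (v, w) of points
  of ℤ^d with v = w (a vertex) or `Adj v w` (a unit edge), both endpoints vertices of one cube of X (`EAdmissible X E`: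
  this, plus admissibility of the polygonal graph `toSegs E` in the sense of `TreeLength.Admissible` — connected,
  inside X, meeting every cube of X); `nedges E` = the number of unit edges; `edgeLen X : ℕ` = the least number of unit
  edges of an admissible edge graph (the length of «the shortest tree graphs formed by edges of cubes»; a unit edge has
  length 1 for the sup, ℓ¹ and ℓ² norms alike, so `edgeLen` does not depend on the metric convention D-T2).
* §2 — lattice-segment geometry: a lattice segment meeting a cube has an ENDPOINT in that cube
  (`corner_mem_cube_of_mem_segment`); a lattice point on a lattice segment is one of its endpoints; two lattice
  segments that meet share an endpoint (`exists_common_endpoint`).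
* §3 — `len (toSegs E) = nedges E`; the infimum `edgeLen X` is ATTAINED («a shortest graph» exists in the edge class,
  `exists_eAdmissible_nedges_eq`); `treeLen X ≤ edgeLen X` (every admissible edge graph is an admissible graph).
* §4 — ADJOINING BY ONE CUBE EDGE: an admissible edge graph for A extends to one for A ∪ {c} (c having a common wall
  with a cube of A) at the cost of at most ONE unit edge of that cube; hence `edgeLen Y + 1 ≤ |Y|` for every
  localization domain Y, and with `TreeLength.card_le_treeLen` (|Y| ≤ 2^d(4·d(Y) + 1)) the AFFINE COMPARISON
  `edgeLen_le_affine_treeLen`:  treeLen Y ≤ edgeLen Y ≤ 4·2^d·treeLen Y + (2^d − 1)  — the printed «equivalent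
  definition» holds UP TO THESE CONSTANTS (which is all that (0.26)-type sums Σ_X e^{−κ d_j(X)} use).
* §5 — counting: the carrier of an admissible edge graph is connected, hence so is the combinatorial graph on its
  lattice endpoints (closed-set separation + §2), hence `(verts E).card ≤ nedges E + 1` (Mathlib
  `SimpleGraph.Connected.card_vert_le_card_edgeSet_add_one`).
* §6 — KERNEL WITNESS that the two definitions are NOT literally equal for the length functional of record: for the
  3^d block X = `block c` (a localization domain) and every d ≥ 2, `treeLen (block c) ≤ 2^(d−1)` (the sup-metric star
  from the centre of the middle cube to its 2^d vertices meets all 3^d cubes) while `2^d − 1 ≤ edgeLen (block c)`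
  (the 2^d corner cubes of the block have pairwise disjoint vertex sets, so an admissible edge graph has ≥ 2^d lattice
  vertices and, being connected, ≥ 2^d − 1 unit edges); d = 2: 2 < 3, d = 4: 8 < 15 (`treeLen_block_lt_edgeLen_block`).
* §7 — the edge-side number is exact: `edgeLen (block c) + 1 = 2^d` (a spanning tree of the middle cube's 2^d
  vertices along cube edges is an admissible edge graph for the block; connectedness via the parent chain
  S ↦ S ∖ {min S} and Mathlib `IsConnected.iUnion_of_reflTransGen`).
* §8 (revision v1.1, append-only; §§1–7 byte-identical to v1.0 = p316520) — VOLUME BOUND for the edge length: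
  each lattice vertex is a vertex of at most 2^d cubes, so |Y| ≤ 2^d·(edgeLen Y + 1) for every localization domain
  (the edge-length analogue of the repaired lower half of [Balaban1988RG2Cluster] (2.30), `TreeLength.card_le_treeLen`,
  with the smaller constant 2^d).
* §9 (v1.1) — `edgeLen Y = 0` iff the cubes of Y have a COMMON VERTEX (a shortest edge graph without unit edges has a
  single lattice vertex, §5, meeting every cube, §4); `edgeLen_singleton`.
* §10 (revision v1.2, append-only) — LINEAR SIZE ZERO for the continuum length: Helly for lattice cubes (common vertex
  ⇔ pairwise index gaps ≤ 1), a coordinate gap ≥ 2 forces d(Y) ≥ 1 (`TreeLength.le_lenIn_closedBall`, the capture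
  lemma), hence the DICHOTOMY d(Y) = 0 ∨ d(Y) ≥ 1, `treeLen_eq_zero_iff` (d(Y) = 0 ⇔ common vertex) and
  `treeLen_eq_zero_iff_edgeLen_eq_zero`: the two definitions AGREE on linear size zero (where §6 shows they differ in
  general).
* §11 (revision v1.3, append-only) — THE EUCLIDEAN READING: `edist2`/`elen` (Euclidean length of a polygonal graph; a
  unit edge has Euclidean length 1, so `elen (toSegs E) = nedges E` as well) and the CROSS (the two diagonals of the
  middle square of the 3 × 3 block, d = 2): admissible, Euclidean length 2√2 < 3 ≤ the Euclidean length of every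
  admissible edge graph (`euclidean_separation_block_two`) — the sentence fails for this X under the Euclidean length
  too; of the usual norms only the ℓ¹ reading is not separated by the witnesses of this file (HONEST SCOPE (a)).

HONEST SCOPE / READING NOTE (cell GAPS.md G-B12-08, DIVERGENCE D-T2).  (a) The print names no metric for «a length of a
… graph»; `TreeLength` fixed the sup metric of [Dimock2013BalabanII] App. E, and §6 refers to THAT functional (§11,
v1.3: the Euclidean length separates the two definitions on the 3 × 3 block as well, 2√2 < 3).  Under
the ℓ¹ length the §6 star has length d·2^(d−1) ≥ 2^d − 1, so this witness does not separate the two definitions for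
ℓ¹ (not formalised; no claim either way is made here about the ℓ¹ reading of the sentence).  (b) Conventions (ii) of
`TreeLength` apply verbatim: infima over connected finite unions of segments / of cube edges rather than over tree
graphs (a tree graph is such a union; for edge graphs a spanning tree of a connected edge graph has no more edges, so
`edgeLen` is also the least edge number of an admissible edge TREE — the pruning itself is not formalised).  (c) What
the paper USES of d_j(X) are the summability statements of (0.26)–(0.27)/(4.36)/[II] (2.27)–(2.30), all insensitive to
an affine change of d_j with κ adjusted; §4 is exactly that affine equivalence, so nothing downstream is affected —
the sentence is recorded as a located reading note, not as an error of the paper.  Value = typed skeleton of a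
printed notion + kernel-checked bookkeeping, NOT summit progress.
-/

namespace Literature.MathematicalPhysics.QuantumFieldTheory.Balaban1983to89.B12EdgeTreeLength257

noncomputable section

open Literature.MathematicalPhysics.QuantumFieldTheory.Balaban1983to89
open Literature.MathematicalPhysics.QuantumFieldTheory.Balaban1983to89.B13ScaleTransfer
open Literature.MathematicalPhysics.QuantumFieldTheory.Balaban1983to89.TreeLength

variable {d : ℕ}

/-! ## §1. Edge graphs («tree graphs formed by edges of cubes in X») and the edge length `edgeLen` -/

/-- The VERTICES of the unit cube of index x ∈ ℤ^d: the lattice points v with v_i ∈ {x_i, x_i + 1} for every i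
([Balaban1987RG1] p. 257: the cubes of π_j rescaled to unit cubes; their edges join such vertices). [cite: Balaban1987RG1, p.257 (linear size d_j, edges of cubes)] -/
def IsVertex (x v : Pt d) : Prop := ∀ i, v i = x i ∨ v i = x i + 1

/-- An (upward oriented) UNIT EDGE of the lattice: w = v + e_i for some axis i. [cite: Balaban1987RG1, p.257 (linear size d_j, edges of cubes)] -/
def IsUpEdge (v w : Pt d) : Prop := ∃ i : Fin d, w = Function.update v i (v i + 1)

/-- A LATTICE PAIR: a vertex (v = w) or a unit edge of the lattice in either orientation (`B13ScaleTransfer.Adj`,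
i.e. w = v ± e_i) — the building blocks of «tree graphs formed by edges of cubes» ([Balaban1987RG1] p. 257). [cite: Balaban1987RG1, p.257 (linear size d_j, edges of cubes)] -/
def IsLatticePair (v w : Pt d) : Prop := v = w ∨ Adj v w

/-- The segment of ℝ^d spanned by a pair of lattice points (as a `TreeLength.Seg`). [cite: Balaban1987RG1, p.257 (linear size d_j, edges of cubes)] -/
def seg (e : Pt d × Pt d) : Seg d := (corner e.1, corner e.2)

/-- The polygonal graph (`TreeLength` list of segments) of a list of lattice pairs. [cite: Balaban1987RG1, p.257 (linear size d_j, edges of cubes)] -/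
def toSegs (E : List (Pt d × Pt d)) : List (Seg d) := E.map seg

/-- ADMISSIBLE EDGE GRAPHS for X — [Balaban1987RG1] p. 257, verbatim: *"tree graphs formed by edges of cubes in X"*
(within *"a class of tree graphs contained in X and intersecting all the cubes in X"*): a finite list of lattice pairs,
each pair consisting of vertices of ONE cube of X (so each unit edge is an edge of a cube of X), whose polygonal graph
is admissible for X in the sense of `TreeLength.Admissible` (connected, contained in the union of the cubes of X,
meeting every cube of X).  Convention (ii) of `TreeLength` (connected unions instead of trees). [cite: Balaban1987RG1, p.257 (linear size d_j, edges of cubes)] -/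
structure EAdmissible (X : Finset (Pt d)) (E : List (Pt d × Pt d)) : Prop where
  /-- every member is a vertex or a unit edge -/
  lattice : ∀ e ∈ E, IsLatticePair e.1 e.2
  /-- every member consists of vertices of one cube of X -/
  ofCube : ∀ e ∈ E, ∃ x ∈ X, IsVertex x e.1 ∧ IsVertex x e.2
  /-- the polygonal graph is admissible for X -/
  admissible : Admissible X (toSegs E)

/-- The number of UNIT EDGES of a list of lattice pairs (members with distinct endpoints, counted with multiplicity). [cite: Balaban1987RG1, p.257 (linear size d_j, edges of cubes)] -/
def nedges (E : List (Pt d × Pt d)) : ℕ := (E.filter fun e => e.1 ≠ e.2).length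

/-- The set of lattice endpoints of a list of lattice pairs. [cite: Balaban1987RG1, p.257 (linear size d_j, edges of cubes)] -/
def verts (E : List (Pt d × Pt d)) : Finset (Pt d) := (E.map Prod.fst ++ E.map Prod.snd).toFinset

/-- The set of edge numbers of the admissible edge graphs for X. [cite: Balaban1987RG1, p.257 (linear size d_j, edges of cubes)] -/
def elengths (X : Finset (Pt d)) : Set ℕ := {n | ∃ E, EAdmissible X E ∧ nedges E = n}

/-- THE EDGE LENGTH of X — the length of «the shortest tree graphs formed by edges of cubes in X» ([Balaban1987RG1]
p. 257, the «equivalent definition»): the least number of unit edges of an admissible edge graph for X.  Junk value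
`sInf ∅ = 0` when X has no admissible edge graph (X empty or not connected). [cite: Balaban1987RG1, p.257 (linear size d_j, edges of cubes)] -/
def edgeLen (X : Finset (Pt d)) : ℕ := sInf (elengths X)

/-- x is a vertex of its own cube. [cite: Balaban1987RG1, p.257 (linear size d_j, edges of cubes)] -/
theorem isVertex_self (x : Pt d) : IsVertex x x := fun _ => Or.inl rfl

/-- A vertex of the cube x lies in the (closed) cube x. [cite: Balaban1987RG1, p.257 (linear size d_j, edges of cubes)] -/
theorem corner_mem_cube_of_isVertex {x v : Pt d} (h : IsVertex x v) : corner v ∈ cube x := by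
  rw [mem_cube]
  intro i
  rcases h i with h | h
  · simp only [corner, h]
    constructor <;> linarith
  · simp only [corner, h, Int.cast_add, Int.cast_one]
    constructor <;> linarith

/-- Conversely, a lattice point lying in the cube x is a vertex of the cube x. [cite: Balaban1987RG1, p.257 (linear size d_j, edges of cubes)] -/
theorem isVertex_of_corner_mem_cube {x v : Pt d} (h : corner v ∈ cube x) : IsVertex x v := by
  intro i
  obtain ⟨h1, h2⟩ := mem_cube.1 h i
  simp only [corner] at h1 h2
  have h1' : x i ≤ v i := by exact_mod_cast h1
  have h2' : v i ≤ x i + 1 := by exact_mod_cast h2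
  omega

/-- An upward unit edge is an `Adj` pair. [cite: Balaban1987RG1, p.257 (linear size d_j, edges of cubes)] -/
theorem IsUpEdge.adj {v w : Pt d} (h : IsUpEdge v w) : Adj v w := by
  obtain ⟨i, hi⟩ := h
  exact ⟨i, Or.inl hi⟩

/-- `Adj v w` iff one of (v, w), (w, v) is an upward unit edge. [cite: Balaban1987RG1, p.257 (linear size d_j, edges of cubes)] -/
theorem adj_iff_isUpEdge {v w : Pt d} : Adj v w ↔ IsUpEdge v w ∨ IsUpEdge w v := by
  constructor
  · rintro ⟨i, h | h⟩
    · exact Or.inl ⟨i, h⟩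
    · exact Or.inr ⟨i, h⟩
  · rintro (⟨i, h⟩ | ⟨i, h⟩)
    · exact ⟨i, Or.inl h⟩
    · exact ⟨i, Or.inr h⟩

/-- The endpoints of an upward unit edge differ. [cite: Balaban1987RG1, p.257 (linear size d_j, edges of cubes)] -/
theorem IsUpEdge.ne {v w : Pt d} (h : IsUpEdge v w) : v ≠ w := by
  obtain ⟨i, hi⟩ := h
  intro hvw
  have := congrFun hi i
  rw [Function.update_self, ← hvw] at this
  omega

/-- Coordinates of an upward unit edge: w_i = v_i + 1 on its axis i and w_j = v_j elsewhere. [cite: Balaban1987RG1, p.257 (linear size d_j, edges of cubes)] -/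
theorem IsUpEdge.coord {v w : Pt d} (h : IsUpEdge v w) :
    ∃ i : Fin d, w i = v i + 1 ∧ ∀ j, j ≠ i → w j = v j := by
  obtain ⟨i, hi⟩ := h
  refine ⟨i, ?_, fun j hj => ?_⟩
  · rw [hi, Function.update_self]
  · rw [hi, Function.update_of_ne hj]

/-- The sup-metric length of a unit edge is 1. [cite: Balaban1987RG1, p.257 (linear size d_j, edges of cubes)] -/
theorem dist_corner_of_isUpEdge {v w : Pt d} (h : IsUpEdge v w) : dist (corner v) (corner w) = 1 := by
  obtain ⟨i, hi, hj⟩ := h.coord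
  apply le_antisymm
  · rw [dist_pi_le_iff zero_le_one]
    intro j
    rw [Real.dist_eq]
    simp only [corner]
    by_cases hji : j = i
    · subst hji
      rw [hi]
      push_cast
      rw [abs_le]
      constructor <;> linarith
    · rw [hj j hji]
      simp
  · have := dist_le_pi_dist (corner v) (corner w) i
    rw [Real.dist_eq] at this
    simp only [corner] at this
    rw [hi] at this
    push_cast at this
    have habs : |(v i : ℝ) - ((v i : ℝ) + 1)| = 1 := by
      rw [abs_of_nonpos (by linarith)]
      ring
    linarith

/-- The sup-metric length of an `Adj` pair is 1. [cite: Balaban1987RG1, p.257 (linear size d_j, edges of cubes)] -/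
theorem dist_corner_of_adj {v w : Pt d} (h : Adj v w) : dist (corner v) (corner w) = 1 := by
  rcases adj_iff_isUpEdge.1 h with h | h
  · exact dist_corner_of_isUpEdge h
  · rw [dist_comm]
    exact dist_corner_of_isUpEdge h

/-- `corner` is injective: lattice points with equal real coordinates are equal. [cite: Balaban1987RG1, p.257 (linear size d_j, edges of cubes)] -/
theorem corner_injective : Function.Injective (corner (d := d)) := by
  intro v w h
  funext i
  have := congrFun h i
  simp only [corner] at this
  exact_mod_cast this

/-! ## §2. Lattice-segment geometry: endpoints in cubes, lattice points on segments, meeting segments -/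

/-- Coordinates of a point of a segment: p = a + t(b − a) with t ∈ [0, 1]. [cite: Balaban1987RG1, p.257 (linear size d_j, edges of cubes)] -/
theorem exists_param_of_mem_segment {a b p : RPt d} (hp : p ∈ segment ℝ a b) :
    ∃ t : ℝ, 0 ≤ t ∧ t ≤ 1 ∧ ∀ j, p j = a j + t * (b j - a j) := by
  rw [segment_eq_image'] at hp
  obtain ⟨t, ⟨ht0, ht1⟩, rfl⟩ := hp
  refine ⟨t, ht0, ht1, fun j => ?_⟩
  simp [smul_eq_mul]

/-- A point of an upward unit edge (v, v + e_i): p_j = v_j for j ≠ i and p_i = v_i + t, t ∈ [0, 1]. [cite: Balaban1987RG1, p.257 (linear size d_j, edges of cubes)] -/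
theorem coord_of_mem_segment_upEdge {v w : Pt d} (h : IsUpEdge v w) {p : RPt d}
    (hp : p ∈ segment ℝ (corner v) (corner w)) :
    ∃ i : Fin d, w i = v i + 1 ∧ (∀ j, j ≠ i → w j = v j) ∧
      ∃ t : ℝ, 0 ≤ t ∧ t ≤ 1 ∧ p i = (v i : ℝ) + t ∧ ∀ j, j ≠ i → p j = (v j : ℝ) := by
  obtain ⟨i, hi, hj⟩ := h.coord
  obtain ⟨t, ht0, ht1, hp⟩ := exists_param_of_mem_segment hp
  refine ⟨i, hi, hj, t, ht0, ht1, ?_, fun j hji => ?_⟩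
  · have := hp i
    simp only [corner, hi, Int.cast_add, Int.cast_one] at this
    linarith
  · have := hp j
    simp only [corner, hj j hji] at this
    linarith

/-- A point of a degenerate segment (v, v) is the lattice point v. [cite: Balaban1987RG1, p.257 (linear size d_j, edges of cubes)] -/
theorem eq_corner_of_mem_segment_self {v : Pt d} {p : RPt d} (hp : p ∈ segment ℝ (corner v) (corner v)) :
    p = corner v := by
  rw [segment_same] at hp
  exact hp

/-- ENDPOINT IN THE CUBE (upward edge): if a unit edge (v, v + e_i) meets the closed cube x, then one of its two
endpoints lies in the cube x. [cite: Balaban1987RG1, p.257 (linear size d_j, edges of cubes)] -/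
theorem corner_mem_cube_of_mem_segment_upEdge {v w x : Pt d} (h : IsUpEdge v w) {p : RPt d}
    (hp : p ∈ segment ℝ (corner v) (corner w)) (hx : p ∈ cube x) : corner v ∈ cube x ∨ corner w ∈ cube x := by
  obtain ⟨i, hi, hj, t, ht0, ht1, hpi, hpj⟩ := coord_of_mem_segment_upEdge h hp
  have hx' := mem_cube.1 hx
  by_cases hcase : (x i : ℝ) ≤ (v i : ℝ)
  · -- the lower endpoint v lies in the cube
    left
    rw [mem_cube]
    intro j
    by_cases hji : j = i
    · subst hji
      obtain ⟨h1, h2⟩ := hx' j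
      simp only [corner]
      constructor <;> linarith
    · obtain ⟨h1, h2⟩ := hx' j
      rw [hpj j hji] at h1 h2
      simp only [corner]
      exact ⟨h1, h2⟩
  · -- v_i < x_i: then x_i = v_i + 1 = w_i and the upper endpoint w lies in the cube
    right
    push Not at hcase
    have hvx : v i + 1 ≤ x i := by
      have : v i < x i := by exact_mod_cast hcase
      omega
    have hvx' : (v i : ℝ) + 1 ≤ (x i : ℝ) := by exact_mod_cast hvx
    obtain ⟨h1i, h2i⟩ := hx' i
    have heq : (x i : ℝ) = (v i : ℝ) + 1 := by linarith
    rw [mem_cube]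
    intro j
    by_cases hji : j = i
    · subst hji
      simp only [corner, hi, Int.cast_add, Int.cast_one]
      constructor <;> linarith
    · obtain ⟨h1, h2⟩ := hx' j
      rw [hpj j hji] at h1 h2
      simp only [corner, hj j hji]
      exact ⟨h1, h2⟩

/-- ENDPOINT IN THE CUBE: if a lattice segment (vertex or unit edge) meets the closed cube x, then one of its
endpoints lies in the cube x — so a graph formed by edges of cubes meets a cube iff one of its lattice vertices is a
vertex of that cube. [cite: Balaban1987RG1, p.257 (linear size d_j, edges of cubes)] -/
theorem corner_mem_cube_of_mem_segment {v w x : Pt d} (h : IsLatticePair v w) {p : RPt d}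
    (hp : p ∈ segment ℝ (corner v) (corner w)) (hx : p ∈ cube x) : corner v ∈ cube x ∨ corner w ∈ cube x := by
  rcases h with rfl | h
  · left
    rw [← eq_corner_of_mem_segment_self hp]
    exact hx
  · rcases adj_iff_isUpEdge.1 h with h | h
    · exact corner_mem_cube_of_mem_segment_upEdge h hp hx
    · rw [segment_symm] at hp
      exact (corner_mem_cube_of_mem_segment_upEdge h hp hx).symm

/-- A LATTICE POINT ON A LATTICE SEGMENT IS AN ENDPOINT (upward edge). [cite: Balaban1987RG1, p.257 (linear size d_j, edges of cubes)] -/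
theorem eq_or_eq_of_corner_mem_segment_upEdge {v w u : Pt d} (h : IsUpEdge v w)
    (hu : corner u ∈ segment ℝ (corner v) (corner w)) : u = v ∨ u = w := by
  obtain ⟨i, hi, hj, t, ht0, ht1, hpi, hpj⟩ := coord_of_mem_segment_upEdge h hu
  simp only [corner] at hpi hpj
  -- t = u_i − v_i is an integer in [0, 1]
  have ht : t = ((u i - v i : ℤ) : ℝ) := by
    push_cast
    linarith
  have hk0 : (0 : ℤ) ≤ u i - v i := by exact_mod_cast ht ▸ ht0
  have hk1 : u i - v i ≤ (1 : ℤ) := by exact_mod_cast ht ▸ ht1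
  have hoff : ∀ j, j ≠ i → u j = v j := fun j hji => by exact_mod_cast hpj j hji
  rcases (show u i - v i = 0 ∨ u i - v i = 1 by omega) with hk | hk
  · left
    funext j
    by_cases hji : j = i
    · subst hji
      omega
    · exact hoff j hji
  · right
    funext j
    by_cases hji : j = i
    · subst hji
      rw [hi]
      omega
    · rw [hj j hji]
      exact hoff j hji

/-- A LATTICE POINT ON A LATTICE SEGMENT IS AN ENDPOINT: if the lattice point u lies on the segment of the lattice
pair (v, w), then u = v or u = w. [cite: Balaban1987RG1, p.257 (linear size d_j, edges of cubes)] -/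
theorem eq_or_eq_of_corner_mem_segment {v w u : Pt d} (h : IsLatticePair v w)
    (hu : corner u ∈ segment ℝ (corner v) (corner w)) : u = v ∨ u = w := by
  rcases h with rfl | h
  · exact Or.inl (corner_injective (eq_corner_of_mem_segment_self hu))
  · rcases adj_iff_isUpEdge.1 h with h | h
    · exact eq_or_eq_of_corner_mem_segment_upEdge h hu
    · rw [segment_symm] at hu
      exact (eq_or_eq_of_corner_mem_segment_upEdge h hu).symm

/-- A point of a lattice segment with a NON-INTEGER coordinate p_j: the segment is a unit edge along the axis j, the
other coordinates of p are those of both endpoints, and p_j lies strictly between the integer endpoint coordinates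
m, m + 1 (upward-edge form). [cite: Balaban1987RG1, p.257 (linear size d_j, edges of cubes)] -/
theorem axis_of_nonint_coord_upEdge {v w : Pt d} (h : IsUpEdge v w) {p : RPt d}
    (hp : p ∈ segment ℝ (corner v) (corner w)) {j : Fin d} (hj : ∀ z : ℤ, p j ≠ (z : ℝ)) :
    (∀ k, k ≠ j → p k = (v k : ℝ) ∧ p k = (w k : ℝ)) ∧
      (v j : ℝ) < p j ∧ p j < (v j : ℝ) + 1 ∧ w j = v j + 1 := by
  obtain ⟨i, hi, hij, t, ht0, ht1, hpi, hpj⟩ := coord_of_mem_segment_upEdge h hp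
  -- the axis of the edge must be j
  have hji : i = j := by
    by_contra hne
    exact hj (v j) (hpj j (Ne.symm hne))
  subst hji
  refine ⟨fun k hk => ⟨hpj k hk, by rw [hij k hk]; exact hpj k hk⟩, ?_, ?_, hi⟩
  · rcases ht0.lt_or_eq with ht0 | ht0
    · linarith
    · exfalso
      apply hj (v i)
      rw [hpi, ← ht0, add_zero]
  · rcases ht1.lt_or_eq with ht1 | ht1
    · linarith
    · exfalso
      apply hj (v i + 1)
      rw [hpi, ht1]
      push_cast
      ring

/-- A point of a lattice segment with a NON-INTEGER coordinate p_j: the pair is a unit edge along the axis j, p agrees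
with both endpoints off j, and there is an integer m with m < p_j < m + 1 and {v_j, w_j} = {m, m + 1}. [cite: Balaban1987RG1, p.257 (linear size d_j, edges of cubes)] -/
theorem axis_of_nonint_coord {v w : Pt d} (h : IsLatticePair v w) {p : RPt d}
    (hp : p ∈ segment ℝ (corner v) (corner w)) {j : Fin d} (hj : ∀ z : ℤ, p j ≠ (z : ℝ)) :
    (∀ k, k ≠ j → p k = (v k : ℝ) ∧ p k = (w k : ℝ)) ∧
      ∃ m : ℤ, (m : ℝ) < p j ∧ p j < (m : ℝ) + 1 ∧
        ((v j = m ∧ w j = m + 1) ∨ (v j = m + 1 ∧ w j = m)) := by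
  rcases h with rfl | h
  · exact absurd (by rw [eq_corner_of_mem_segment_self hp]; rfl) (hj (v j))
  · rcases adj_iff_isUpEdge.1 h with h | h
    · obtain ⟨hoff, h1, h2, hw⟩ := axis_of_nonint_coord_upEdge h hp hj
      exact ⟨hoff, v j, h1, h2, Or.inl ⟨rfl, hw⟩⟩
    · rw [segment_symm] at hp
      obtain ⟨hoff, h1, h2, hv⟩ := axis_of_nonint_coord_upEdge h hp hj
      exact ⟨fun k hk => (hoff k hk).symm, w j, h1, h2, Or.inr ⟨hv, rfl⟩⟩

/-- TWO LATTICE SEGMENTS THAT MEET SHARE AN ENDPOINT: if the segments of the lattice pairs (v, w) and (v′, w′) have a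
common point, then they have a common lattice endpoint.  (Either the common point is a lattice point — then it is an
endpoint of both — or it has a non-integer coordinate, and then both pairs are the same unit edge.) [cite: Balaban1987RG1, p.257 (linear size d_j, edges of cubes)] -/
theorem exists_common_endpoint {v w v' w' : Pt d} (h : IsLatticePair v w) (h' : IsLatticePair v' w') {p : RPt d}
    (hp : p ∈ segment ℝ (corner v) (corner w)) (hp' : p ∈ segment ℝ (corner v') (corner w')) :
    ∃ u : Pt d, (u = v ∨ u = w) ∧ (u = v' ∨ u = w') := by
  by_cases hint : ∀ j, ∃ z : ℤ, p j = (z : ℝ)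
  · -- p is a lattice point
    choose u hu using hint
    have hpu : p = corner u := funext hu
    rw [hpu] at hp hp'
    exact ⟨u, eq_or_eq_of_corner_mem_segment h hp, eq_or_eq_of_corner_mem_segment h' hp'⟩
  · push Not at hint
    obtain ⟨j, hj⟩ := hint
    obtain ⟨hoff, m, hm1, hm2, hvw⟩ := axis_of_nonint_coord h hp hj
    obtain ⟨hoff', m', hm1', hm2', hvw'⟩ := axis_of_nonint_coord h' hp' hj
    -- the two unit intervals containing the non-integer p_j coincide
    have hmm : m = m' := by
      have h1 : m < m' + 1 := by exact_mod_cast (hm1.trans hm2' : (m : ℝ) < (m' : ℝ) + 1)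
      have h2 : m' < m + 1 := by exact_mod_cast (hm1'.trans hm2 : (m' : ℝ) < (m : ℝ) + 1)
      omega
    subst hmm
    -- off the axis all four lattice points agree
    have hvv' : ∀ k, k ≠ j → v k = v' k := fun k hk => by
      have := (hoff k hk).1.symm.trans (hoff' k hk).1
      exact_mod_cast this
    have hvw'' : ∀ k, k ≠ j → v k = w' k := fun k hk => by
      have := (hoff k hk).1.symm.trans (hoff' k hk).2
      exact_mod_cast this
    refine ⟨v, Or.inl rfl, ?_⟩
    -- on the axis, v_j ∈ {m, m+1} = {v′_j, w′_j}
    have hvj : v j = m ∨ v j = m + 1 := by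
      rcases hvw with ⟨h1, -⟩ | ⟨h1, -⟩
      · exact Or.inl h1
      · exact Or.inr h1
    rcases hvw' with ⟨hv'j, hw'j⟩ | ⟨hv'j, hw'j⟩
    · rcases hvj with hvj | hvj
      · left
        funext k
        by_cases hk : k = j
        · subst hk; rw [hvj, hv'j]
        · exact hvv' k hk
      · right
        funext k
        by_cases hk : k = j
        · subst hk; rw [hvj, hw'j]
        · exact hvw'' k hk
    · rcases hvj with hvj | hvj
      · right
        funext k
        by_cases hk : k = j
        · subst hk; rw [hvj, hw'j]
        · exact hvw'' k hk
      · left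
        funext k
        by_cases hk : k = j
        · subst hk; rw [hvj, hv'j]
        · exact hvv' k hk

/-! ## §3. Lengths of edge graphs; `edgeLen` is attained; `treeLen ≤ edgeLen` -/

/-- The sup-metric length of the segment of a lattice pair: 0 for a vertex, 1 for a unit edge. [cite: Balaban1987RG1, p.257 (linear size d_j, edges of cubes)] -/
theorem dist_seg_of_isLatticePair {v w : Pt d} (h : IsLatticePair v w) :
    dist (corner v) (corner w) = if v = w then 0 else 1 := by
  split_ifs with hvw
  · rw [hvw, dist_self]
  · rcases h with h | h
    · exact absurd h hvw
    · exact dist_corner_of_adj h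

/-- `toSegs` of a cons. [cite: Balaban1987RG1, p.257 (linear size d_j, edges of cubes)] -/
@[simp] theorem toSegs_cons (e : Pt d × Pt d) (E : List (Pt d × Pt d)) :
    toSegs (e :: E) = (corner e.1, corner e.2) :: toSegs E := rfl

/-- `toSegs` of the empty list. [cite: Balaban1987RG1, p.257 (linear size d_j, edges of cubes)] -/
@[simp] theorem toSegs_nil : toSegs ([] : List (Pt d × Pt d)) = [] := rfl

/-- `nedges` of a cons: a unit edge counts 1, a vertex counts 0. [cite: Balaban1987RG1, p.257 (linear size d_j, edges of cubes)] -/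
theorem nedges_cons (e : Pt d × Pt d) (E : List (Pt d × Pt d)) :
    nedges (e :: E) = (if e.1 = e.2 then 0 else 1) + nedges E := by
  unfold nedges
  rw [List.filter_cons]
  by_cases h : e.1 = e.2
  · simp [h]
  · simp [h, add_comm]

/-- `nedges` of the empty list. [cite: Balaban1987RG1, p.257 (linear size d_j, edges of cubes)] -/
@[simp] theorem nedges_nil : nedges ([] : List (Pt d × Pt d)) = 0 := rfl

/-- THE LENGTH OF AN EDGE GRAPH IS ITS NUMBER OF UNIT EDGES (sup metric; the same count for the ℓ¹/ℓ² lengths of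
unit edges). [cite: Balaban1987RG1, p.257 (linear size d_j, edges of cubes)] -/
theorem len_toSegs {E : List (Pt d × Pt d)} (h : ∀ e ∈ E, IsLatticePair e.1 e.2) :
    len (toSegs E) = (nedges E : ℝ) := by
  induction E with
  | nil => simp
  | cons e E ih =>
    rw [toSegs_cons, len_cons, nedges_cons, ih fun e' he' => h e' (List.mem_cons_of_mem _ he')]
    change dist (corner e.1) (corner e.2) + _ = _
    rw [dist_seg_of_isLatticePair (h e List.mem_cons_self)]
    split_ifs <;> push_cast <;> ring

/-- `edgeLen X` is at most the number of unit edges of any admissible edge graph for X. [cite: Balaban1987RG1, p.257 (linear size d_j, edges of cubes)] -/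
theorem edgeLen_le_nedges {X : Finset (Pt d)} {E : List (Pt d × Pt d)} (hE : EAdmissible X E) :
    edgeLen X ≤ nedges E :=
  Nat.sInf_le ⟨E, hE, rfl⟩

/-- «A SHORTEST GRAPH» EXISTS in the edge class: the infimum `edgeLen X` is attained (edge numbers are natural
numbers), provided X has an admissible edge graph at all. [cite: Balaban1987RG1, p.257 (linear size d_j, edges of cubes)] -/
theorem exists_eAdmissible_nedges_eq {X : Finset (Pt d)} (hne : ∃ E, EAdmissible X E) :
    ∃ E, EAdmissible X E ∧ nedges E = edgeLen X := by
  obtain ⟨E, hE⟩ := hne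
  exact Nat.sInf_mem (s := elengths X) ⟨nedges E, E, hE, rfl⟩

/-- A lower bound of the edge numbers of all admissible edge graphs is a lower bound of `edgeLen X` (class
non-empty). [cite: Balaban1987RG1, p.257 (linear size d_j, edges of cubes)] -/
theorem le_edgeLen {X : Finset (Pt d)} {a : ℕ} (hne : ∃ E, EAdmissible X E)
    (h : ∀ E, EAdmissible X E → a ≤ nedges E) : a ≤ edgeLen X := by
  obtain ⟨E, hE, hn⟩ := exists_eAdmissible_nedges_eq hne
  rw [← hn]
  exact h E hE

/-- FIRST HALF OF THE COMPARISON: d_j(X) ≤ the edge length — every admissible edge graph is an admissible graph of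
length = its number of unit edges ([Balaban1987RG1] p. 257: the edge class is a subclass of «tree graphs contained
in X and intersecting all the cubes in X»). [cite: Balaban1987RG1, p.257 (linear size d_j, edges of cubes)] -/
theorem treeLen_le_edgeLen {X : Finset (Pt d)} (hne : ∃ E, EAdmissible X E) :
    treeLen X ≤ (edgeLen X : ℝ) := by
  obtain ⟨E, hE, hn⟩ := exists_eAdmissible_nedges_eq hne
  have := treeLen_le_len hE.admissible
  rwa [len_toSegs hE.lattice, hn] at this

/-! ## §4. Adjoining a cube by ONE cube edge; `edgeLen Y + 1 ≤ |Y|`; the affine comparison with `treeLen` -/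

/-- The one-vertex edge graph [(x, x)] is admissible for the single cube {x} (0 unit edges). [cite: Balaban1987RG1, p.257 (linear size d_j, edges of cubes)] -/
theorem eAdmissible_singleton (x : Pt d) : EAdmissible ({x} : Finset (Pt d)) [(x, x)] := by
  refine ⟨?_, ?_, ?_⟩
  · intro e he
    rw [List.mem_singleton] at he
    subst he
    exact Or.inl rfl
  · intro e he
    rw [List.mem_singleton] at he
    subst he
    exact ⟨x, Finset.mem_singleton_self x, isVertex_self x, isVertex_self x⟩
  · exact admissible_singleton x

/-- An admissible edge graph meets every cube of X AT A VERTEX of that cube which is one of its lattice endpoints. [cite: Balaban1987RG1, p.257 (linear size d_j, edges of cubes)] -/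
theorem exists_vertex_mem_carrier {X : Finset (Pt d)} {E : List (Pt d × Pt d)} (hE : EAdmissible X E) {x : Pt d}
    (hx : x ∈ X) : ∃ u ∈ verts E, IsVertex x u ∧ corner u ∈ carrier (toSegs E) := by
  obtain ⟨p, hpT, hpx⟩ := hE.admissible.meets x hx
  obtain ⟨s, hs, hps⟩ := mem_carrier.1 hpT
  unfold toSegs at hs
  rw [List.mem_map] at hs
  obtain ⟨e, he, rfl⟩ := hs
  have hseg : segment ℝ (corner e.1) (corner e.2) ⊆ carrier (toSegs E) :=
    segment_subset_carrier (T := toSegs E) (s := seg e) (List.mem_map.2 ⟨e, he, rfl⟩)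
  rcases corner_mem_cube_of_mem_segment (hE.lattice e he) hps hpx with h1 | h2
  · refine ⟨e.1, ?_, isVertex_of_corner_mem_cube h1, hseg (left_mem_segment ℝ _ _)⟩
    unfold verts
    rw [List.mem_toFinset, List.mem_append]
    exact Or.inl (List.mem_map.2 ⟨e, he, rfl⟩)
  · refine ⟨e.2, ?_, isVertex_of_corner_mem_cube h2, hseg (right_mem_segment ℝ _ _)⟩
    unfold verts
    rw [List.mem_toFinset, List.mem_append]
    exact Or.inr (List.mem_map.2 ⟨e, he, rfl⟩)

/-- WALL VERTEX: from a vertex u of the cube a and a cube c having a common wall with a, the vertex u′ of a obtained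
by moving u onto the common wall is a vertex of BOTH cubes, and (u, u′) is a lattice pair (u′ = u or u′ = u ± e_i)
— the edge-graph version of `TreeLength.exists_wall_point` (cost ≤ one cube edge instead of one segment). [cite: Balaban1987RG1, p.257 (linear size d_j, edges of cubes)] -/
theorem exists_wall_vertex {a c u : Pt d} (hac : Adj a c) (hu : IsVertex a u) :
    ∃ u' : Pt d, IsLatticePair u u' ∧ IsVertex a u' ∧ IsVertex c u' := by
  obtain ⟨i, h | h⟩ := hac
  · -- c = a + e_i : move u_i to a_i + 1
    have hci : c i = a i + 1 := by rw [h, Function.update_self]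
    have hcj : ∀ j, j ≠ i → c j = a j := fun j hj => by rw [h, Function.update_of_ne hj]
    refine ⟨Function.update u i (a i + 1), ?_, ?_, ?_⟩
    · rcases hu i with hui | hui
      · right
        refine ⟨i, Or.inl ?_⟩
        rw [hui]
      · left
        rw [← hui, Function.update_eq_self]
    · intro j
      by_cases hj : j = i
      · subst hj
        rw [Function.update_self]
        exact Or.inr rfl
      · rw [Function.update_of_ne hj]
        exact hu j
    · intro j
      by_cases hj : j = i
      · subst hj
        rw [Function.update_self, hci]
        exact Or.inl rfl
      · rw [Function.update_of_ne hj, hcj j hj]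
        exact hu j
  · -- a = c + e_i : move u_i to a_i
    have hai : a i = c i + 1 := by rw [h, Function.update_self]
    have haj : ∀ j, j ≠ i → a j = c j := fun j hj => by rw [h, Function.update_of_ne hj]
    refine ⟨Function.update u i (a i), ?_, ?_, ?_⟩
    · rcases hu i with hui | hui
      · left
        rw [← hui, Function.update_eq_self]
      · right
        refine ⟨i, Or.inr ?_⟩
        funext j
        by_cases hj : j = i
        · subst hj
          rw [Function.update_self, Function.update_self, hui]
        · rw [Function.update_of_ne hj, Function.update_of_ne hj]
    · intro j
      by_cases hj : j = i
      · subst hj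
        rw [Function.update_self]
        exact Or.inl rfl
      · rw [Function.update_of_ne hj]
        exact hu j
    · intro j
      by_cases hj : j = i
      · subst hj
        rw [Function.update_self, hai]
        exact Or.inr rfl
      · rw [Function.update_of_ne hj, ← haj j hj]
        exact hu j

/-- ADJOIN STEP BY ONE CUBE EDGE: an admissible edge graph for A extends to one for A ∪ {c}, c a cube having a common
wall with a cube a of A, by adding at most ONE unit edge of the cube a (from a lattice vertex of the graph in the cube
a to the common wall). [cite: Balaban1987RG1, p.257 (linear size d_j, edges of cubes)] -/
theorem eAdjoin_step {A : Finset (Pt d)} {E : List (Pt d × Pt d)} (hE : EAdmissible A E) {a c : Pt d} (ha : a ∈ A)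
    (hac : Adj a c) : ∃ E', EAdmissible (insert c A) E' ∧ nedges E' ≤ nedges E + 1 := by
  obtain ⟨u, -, hua, huT⟩ := exists_vertex_mem_carrier hE ha
  obtain ⟨u', huu', hu'a, hu'c⟩ := exists_wall_vertex hac hua
  refine ⟨(u, u') :: E, ⟨?_, ?_, ⟨?_, ?_, ?_⟩⟩, ?_⟩
  · intro e he
    rcases List.mem_cons.1 he with rfl | he
    · exact huu'
    · exact hE.lattice e he
  · intro e he
    rcases List.mem_cons.1 he with rfl | he
    · exact ⟨a, Finset.mem_insert_of_mem ha, hua, hu'a⟩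
    · obtain ⟨x, hx, h1, h2⟩ := hE.ofCube e he
      exact ⟨x, Finset.mem_insert_of_mem hx, h1, h2⟩
  · rw [toSegs_cons, carrier_cons]
    exact IsConnected.union ⟨corner u, left_mem_segment ℝ _ _, huT⟩
      ((convex_segment _ _).isConnected ⟨corner u, left_mem_segment ℝ _ _⟩) hE.admissible.connected
  · rw [toSegs_cons, carrier_cons, Set.union_subset_iff]
    exact ⟨((convex_cube a).segment_subset (corner_mem_cube_of_isVertex hua)
        (corner_mem_cube_of_isVertex hu'a)).trans (cube_subset_cubes (Finset.mem_insert_of_mem ha)),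
      hE.admissible.subset.trans (cubes_mono (Finset.subset_insert c A))⟩
  · intro x hx
    rw [toSegs_cons, carrier_cons]
    rcases Finset.mem_insert.1 hx with rfl | hx
    · exact ⟨corner u', Set.mem_union_left _ (right_mem_segment ℝ _ _), corner_mem_cube_of_isVertex hu'c⟩
    · obtain ⟨r, hr, hrx⟩ := hE.admissible.meets x hx
      exact ⟨r, Set.mem_union_right _ hr, hrx⟩
  · rw [nedges_cons]
    split_ifs <;> omega

/-- ADJOINING, iterated: an admissible edge graph for A ⊆ Y, Y a localization domain, extends to one for Y with at
most |Y ∖ A| more unit edges (induction along frontier cubes, `TreeLength.exists_frontier`). [cite: Balaban1987RG1, p.257 (linear size d_j, edges of cubes)] -/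
theorem exists_eAdmissible_extend {Y : Finset (Pt d)} (hY : FaceConnected Y) :
    ∀ n : ℕ, ∀ (A : Finset (Pt d)) (E : List (Pt d × Pt d)), A ⊆ Y → (Y \ A).card = n → EAdmissible A E →
      ∃ E', EAdmissible Y E' ∧ nedges E' ≤ nedges E + n := by
  intro n
  induction n with
  | zero =>
    intro A E hAY hcard hE
    have hAeq : A = Y :=
      Finset.Subset.antisymm hAY (Finset.sdiff_eq_empty_iff_subset.1 (Finset.card_eq_zero.1 hcard))
    subst hAeq
    exact ⟨E, hE, by simp⟩
  | succ n ih =>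
    intro A E hAY hcard hE
    obtain ⟨x₀, hx₀⟩ := hE.admissible.finset_nonempty
    have hne : (Y \ A).Nonempty := by
      rw [← Finset.card_pos, hcard]
      exact Nat.succ_pos n
    obtain ⟨y, hy⟩ := hne
    rw [Finset.mem_sdiff] at hy
    obtain ⟨a, ha, c, hc, hcA, hac⟩ := exists_frontier hAY hY hx₀ hy.1 hy.2
    obtain ⟨E₁, hE₁, hlen₁⟩ := eAdjoin_step hE ha hac
    have hsub : insert c A ⊆ Y := Finset.insert_subset hc hAY
    have hcard' : (Y \ insert c A).card = n := by
      rw [Finset.sdiff_insert, Finset.card_erase_of_mem (Finset.mem_sdiff.2 ⟨hc, hcA⟩), hcard]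
      simp
    obtain ⟨E', hE', hlen'⟩ := ih (insert c A) E₁ hsub hcard' hE₁
    exact ⟨E', hE', by omega⟩

/-- EVERY LOCALIZATION DOMAIN HAS AN ADMISSIBLE EDGE GRAPH, with at most |Y| − 1 unit edges (grow it from one vertex,
one cube edge per further cube). [cite: Balaban1987RG1, p.257 (linear size d_j, edges of cubes)] -/
theorem exists_eAdmissible {Y : Finset (Pt d)} (hY : Y.Nonempty) (hc : FaceConnected Y) :
    ∃ E, EAdmissible Y E ∧ nedges E + 1 ≤ Y.card := by
  obtain ⟨x, hx⟩ := hY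
  have hxY : ({x} : Finset (Pt d)) ⊆ Y := Finset.singleton_subset_iff.2 hx
  obtain ⟨E', hE', hlen⟩ := exists_eAdmissible_extend hc _ {x} [(x, x)] hxY rfl (eAdmissible_singleton x)
  refine ⟨E', hE', ?_⟩
  have h1 : (Y \ {x}).card + 1 = Y.card := by
    have := Finset.card_sdiff_add_card_eq_card hxY
    simpa using this
  have h0 : nedges [(x, x)] = 0 := by simp [nedges_cons]
  omega

/-- THE EDGE LENGTH OF A LOCALIZATION DOMAIN IS AT MOST |Y| − 1 (the edge-graph twin of the upper half of
[Balaban1988RG2Cluster] (2.30) `TreeLength.treeLen_le_card_sub_one`). [cite: Balaban1987RG1, p.257 (linear size d_j, edges of cubes)] -/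
theorem edgeLen_add_one_le_card {Y : Finset (Pt d)} (hY : Y.Nonempty) (hc : FaceConnected Y) :
    edgeLen Y + 1 ≤ Y.card := by
  obtain ⟨E, hE, hlen⟩ := exists_eAdmissible hY hc
  exact (Nat.add_le_add_right (edgeLen_le_nedges hE) 1).trans hlen

/-- `treeLen ≤ edgeLen` for localization domains (the edge class is non-empty). [cite: Balaban1987RG1, p.257 (linear size d_j, edges of cubes)] -/
theorem treeLen_le_edgeLen_of_faceConnected {Y : Finset (Pt d)} (hY : Y.Nonempty) (hc : FaceConnected Y) :
    treeLen Y ≤ (edgeLen Y : ℝ) := by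
  obtain ⟨E, hE, -⟩ := exists_eAdmissible hY hc
  exact treeLen_le_edgeLen ⟨E, hE⟩

/-- THE «EQUIVALENT DEFINITION» UP TO CONSTANTS — [Balaban1987RG1] p. 257, *"hence an equivalent definition can be
formulated, based on such graphs only"*, in the form that survives for the length functional of record: for every
localization domain Y,  d(Y) ≤ edgeLen Y ≤ 4·2^d·d(Y) + (2^d − 1)  (upper bound from `edgeLen_add_one_le_card` and
the linear volume bound `TreeLength.card_le_treeLen` |Y| ≤ 2^d(4 d(Y) + 1); d = 4: edgeLen ≤ 64 d_j + 15).  PROVED;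
literal equality fails, §6. [cite: Balaban1987RG1, p.257 (linear size d_j, edges of cubes)] -/
theorem edgeLen_le_affine_treeLen {Y : Finset (Pt d)} (hY : Y.Nonempty) (hc : FaceConnected Y) :
    treeLen Y ≤ (edgeLen Y : ℝ) ∧ (edgeLen Y : ℝ) ≤ 4 * 2 ^ d * treeLen Y + (2 ^ d - 1) := by
  refine ⟨treeLen_le_edgeLen_of_faceConnected hY hc, ?_⟩
  have h1 : ((edgeLen Y + 1 : ℕ) : ℝ) ≤ (Y.card : ℝ) := by exact_mod_cast edgeLen_add_one_le_card hY hc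
  push_cast at h1
  have h2 := card_le_treeLen hY hc
  linarith

/-- The same comparison in dimension 4 with the numerical constants: d(Y) ≤ edgeLen Y ≤ 64·d(Y) + 15. [cite: Balaban1987RG1, p.257 (linear size d_j, edges of cubes)] -/
theorem edgeLen_le_affine_treeLen_four {Y : Finset (Pt 4)} (hY : Y.Nonempty) (hc : FaceConnected Y) :
    treeLen Y ≤ (edgeLen Y : ℝ) ∧ (edgeLen Y : ℝ) ≤ 64 * treeLen Y + 15 := by
  obtain ⟨h1, h2⟩ := edgeLen_le_affine_treeLen hY hc
  exact ⟨h1, by norm_num at h2; linarith⟩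


/-! ## §5. Counting: a connected edge graph has at least (number of its lattice vertices) − 1 unit edges -/

/-- Membership in the set of lattice endpoints. [cite: Balaban1987RG1, p.257 (linear size d_j, edges of cubes)] -/
theorem mem_verts {E : List (Pt d × Pt d)} {u : Pt d} : u ∈ verts E ↔ ∃ e ∈ E, u = e.1 ∨ u = e.2 := by
  unfold verts
  simp only [List.mem_toFinset, List.mem_append, List.mem_map]
  constructor
  · rintro (⟨e, he, he'⟩ | ⟨e, he, he'⟩)
    · exact ⟨e, he, Or.inl he'.symm⟩
    · exact ⟨e, he, Or.inr he'.symm⟩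
  · rintro ⟨e, he, h | h⟩
    · exact Or.inl ⟨e, he, h.symm⟩
    · exact Or.inr ⟨e, he, h.symm⟩

/-- The first endpoint of a member is a lattice vertex of the graph. [cite: Balaban1987RG1, p.257 (linear size d_j, edges of cubes)] -/
theorem fst_mem_verts {E : List (Pt d × Pt d)} {e : Pt d × Pt d} (he : e ∈ E) : e.1 ∈ verts E :=
  mem_verts.2 ⟨e, he, Or.inl rfl⟩

/-- The second endpoint of a member is a lattice vertex of the graph. [cite: Balaban1987RG1, p.257 (linear size d_j, edges of cubes)] -/
theorem snd_mem_verts {E : List (Pt d × Pt d)} {e : Pt d × Pt d} (he : e ∈ E) : e.2 ∈ verts E :=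
  mem_verts.2 ⟨e, he, Or.inr rfl⟩

/-- An endpoint of the pair e lies on the segment of e. [cite: Balaban1987RG1, p.257 (linear size d_j, edges of cubes)] -/
theorem corner_mem_segment_of_endpoint {u : Pt d} {e : Pt d × Pt d} (h : u = e.1 ∨ u = e.2) :
    corner u ∈ segment ℝ (corner e.1) (corner e.2) := by
  rcases h with rfl | rfl
  · exact left_mem_segment ℝ _ _
  · exact right_mem_segment ℝ _ _

/-- Every lattice vertex of the graph lies on its carrier. [cite: Balaban1987RG1, p.257 (linear size d_j, edges of cubes)] -/
theorem corner_mem_carrier_of_mem_verts {E : List (Pt d × Pt d)} {u : Pt d} (hu : u ∈ verts E) :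
    corner u ∈ carrier (toSegs E) := by
  obtain ⟨e, he, h⟩ := mem_verts.1 hu
  exact segment_subset_carrier (T := toSegs E) (s := seg e) (List.mem_map.2 ⟨e, he, rfl⟩)
    (corner_mem_segment_of_endpoint h)

/-- THE COMBINATORIAL GRAPH of a list of lattice pairs: vertices = its lattice endpoints, a ~ b iff a ≠ b and (a, b)
or (b, a) is a member (Mathlib `SimpleGraph.fromRel`). [cite: Balaban1987RG1, p.257 (linear size d_j, edges of cubes)] -/
def cgraph (E : List (Pt d × Pt d)) : SimpleGraph (verts E) :=
  SimpleGraph.fromRel fun a b => ((a : Pt d), (b : Pt d)) ∈ E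

/-- The two endpoints of a member are joined in the combinatorial graph (equal or adjacent). [cite: Balaban1987RG1, p.257 (linear size d_j, edges of cubes)] -/
theorem cgraph_reachable_endpoints {E : List (Pt d × Pt d)} {e : Pt d × Pt d} (he : e ∈ E) :
    (cgraph E).Reachable ⟨e.1, fst_mem_verts he⟩ ⟨e.2, snd_mem_verts he⟩ := by
  by_cases heq : e.1 = e.2
  · have : (⟨e.1, fst_mem_verts he⟩ : verts E) = ⟨e.2, snd_mem_verts he⟩ := Subtype.ext heq
    rw [this]
  · refine SimpleGraph.Adj.reachable ?_
    rw [cgraph, SimpleGraph.fromRel_adj]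
    refine ⟨fun h => heq (congrArg Subtype.val h), Or.inl ?_⟩
    simpa using he

/-- The number of edges of the combinatorial graph is at most the number of unit edges of the list (each
combinatorial edge comes from a member with distinct endpoints). [cite: Balaban1987RG1, p.257 (linear size d_j, edges of cubes)] -/
theorem card_edgeSet_cgraph_le (E : List (Pt d × Pt d)) : Nat.card (cgraph E).edgeSet ≤ nedges E := by
  classical
  set F : List (Pt d × Pt d) := E.filter fun e => e.1 ≠ e.2 with hF
  have hFE : ∀ e ∈ F.toFinset, e ∈ E ∧ e.1 ≠ e.2 := fun e he => by
    rw [List.mem_toFinset, hF, List.mem_filter] at he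
    exact ⟨he.1, by simpa using he.2⟩
  -- the map from the members with distinct endpoints onto the edge set
  let ψ : ↥F.toFinset → (cgraph E).edgeSet := fun e =>
    ⟨s(⟨e.1.1, fst_mem_verts (hFE e.1 e.2).1⟩, ⟨e.1.2, snd_mem_verts (hFE e.1 e.2).1⟩), by
      rw [SimpleGraph.mem_edgeSet, cgraph, SimpleGraph.fromRel_adj]
      refine ⟨fun h => (hFE e.1 e.2).2 (congrArg Subtype.val h), Or.inl ?_⟩
      simpa using (hFE e.1 e.2).1⟩
  have hsurj : Function.Surjective ψ := by
    rintro ⟨z, hz⟩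
    induction z using Sym2.ind with
    | h x y =>
      rw [SimpleGraph.mem_edgeSet, cgraph, SimpleGraph.fromRel_adj] at hz
      obtain ⟨hne, hxy | hyx⟩ := hz
      · have hmem : ((x : Pt d), (y : Pt d)) ∈ F.toFinset := by
          rw [List.mem_toFinset, hF, List.mem_filter]
          exact ⟨hxy, by simpa using fun h => hne (Subtype.ext h)⟩
        exact ⟨⟨_, hmem⟩, rfl⟩
      · have hmem : ((y : Pt d), (x : Pt d)) ∈ F.toFinset := by
          rw [List.mem_toFinset, hF, List.mem_filter]
          exact ⟨hyx, by simpa using fun h => hne (Subtype.ext h).symm⟩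
        refine ⟨⟨_, hmem⟩, ?_⟩
        exact Subtype.ext Sym2.eq_swap
  calc Nat.card (cgraph E).edgeSet ≤ Nat.card ↥F.toFinset :=
        Nat.card_le_card_of_surjective ψ hsurj
    _ = F.toFinset.card := by rw [Nat.card_eq_fintype_card, Fintype.card_coe]
    _ ≤ F.length := List.toFinset_card_le F
    _ = nedges E := rfl

/-- TOPOLOGICAL ⇒ COMBINATORIAL CONNECTEDNESS: the carrier of an admissible edge graph is connected, hence its
combinatorial graph is connected.  (Closed-set separation: the segments whose endpoints are reachable from a fixed
vertex, and the others, form two closed sets covering the carrier; by `exists_common_endpoint` they are disjoint on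
it; a lattice vertex lying on a segment is an endpoint of it, §2.) [cite: Balaban1987RG1, p.257 (linear size d_j, edges of cubes)] -/
theorem cgraph_connected {X : Finset (Pt d)} {E : List (Pt d × Pt d)} (hE : EAdmissible X E) :
    (cgraph E).Connected := by
  classical
  obtain ⟨x₀, hx₀⟩ := hE.admissible.finset_nonempty
  obtain ⟨a₀, ha₀, -, -⟩ := exists_vertex_mem_carrier hE hx₀
  haveI : Nonempty (verts E) := ⟨⟨a₀, ha₀⟩⟩
  refine SimpleGraph.Connected.mk (fun a b => ?_)
  -- the reachability class of a, as a set of lattice points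
  set C : Set (Pt d) := {u | ∃ h : u ∈ verts E, (cgraph E).Reachable a ⟨u, h⟩} with hC
  have hkey : ∀ e ∈ E, (e.1 ∈ C ↔ e.2 ∈ C) := by
    intro e he
    have hr := cgraph_reachable_endpoints he
    constructor
    · rintro ⟨h1, h⟩
      exact ⟨snd_mem_verts he, h.trans hr⟩
    · rintro ⟨h2, h⟩
      exact ⟨fst_mem_verts he, h.trans hr.symm⟩
  have hend : ∀ e ∈ E, ∀ u, (u = e.1 ∨ u = e.2) → (u ∈ C ↔ e.1 ∈ C) := by
    rintro e he u (rfl | rfl)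
    · rfl
    · exact (hkey e he).symm
  -- the two closed pieces
  set A : Set (RPt d) := ⋃ e ∈ {e : Pt d × Pt d | e ∈ E ∧ e.1 ∈ C}, segment ℝ (corner e.1) (corner e.2) with hA
  set B : Set (RPt d) := ⋃ e ∈ {e : Pt d × Pt d | e ∈ E ∧ e.1 ∉ C}, segment ℝ (corner e.1) (corner e.2) with hB
  have hAc : IsClosed A :=
    ((List.finite_toSet E).subset fun e he => he.1).isClosed_biUnion fun e _ => isClosed_segment' (seg e)
  have hBc : IsClosed B :=
    ((List.finite_toSet E).subset fun e he => he.1).isClosed_biUnion fun e _ => isClosed_segment' (seg e)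
  have hcover : carrier (toSegs E) ⊆ A ∪ B := by
    intro p hp
    obtain ⟨s, hs, hps⟩ := mem_carrier.1 hp
    obtain ⟨e, he, rfl⟩ := List.mem_map.1 hs
    by_cases h1 : e.1 ∈ C
    · exact Or.inl (Set.mem_biUnion (show e ∈ {e : Pt d × Pt d | e ∈ E ∧ e.1 ∈ C} from ⟨he, h1⟩) hps)
    · exact Or.inr (Set.mem_biUnion (show e ∈ {e : Pt d × Pt d | e ∈ E ∧ e.1 ∉ C} from ⟨he, h1⟩) hps)
  have hdisj : carrier (toSegs E) ∩ (A ∩ B) = ∅ := by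
    ext p
    simp only [Set.mem_inter_iff, Set.mem_empty_iff_false, iff_false, not_and]
    intro _ hpA hpB
    rw [hA, Set.mem_iUnion₂] at hpA
    rw [hB, Set.mem_iUnion₂] at hpB
    obtain ⟨e, ⟨he, he1⟩, hpe⟩ := hpA
    obtain ⟨e', ⟨he', he'1⟩, hpe'⟩ := hpB
    obtain ⟨u, hu, hu'⟩ := exists_common_endpoint (hE.lattice e he) (hE.lattice e' he') hpe hpe'
    exact he'1 ((hend e' he' u hu').1 ((hend e he u hu).2 he1))
  have hsep := (isPreconnected_iff_subset_of_disjoint_closed.1 hE.admissible.connected.isPreconnected)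
    A B hAc hBc hcover hdisj
  have haC : (a : Pt d) ∈ C := ⟨a.2, SimpleGraph.Reachable.refl _⟩
  rcases hsep with hsub | hsub
  · -- carrier ⊆ A: every lattice vertex is reachable from a
    have hbA := hsub (corner_mem_carrier_of_mem_verts b.2)
    rw [hA, Set.mem_iUnion₂] at hbA
    obtain ⟨e₁, ⟨he₁, he₁C⟩, hb₁⟩ := hbA
    have hb' := eq_or_eq_of_corner_mem_segment (hE.lattice e₁ he₁) hb₁
    obtain ⟨hb, hr⟩ := (hend e₁ he₁ b hb').2 he₁C
    exact hr
  · -- carrier ⊆ B is absurd: the vertex a itself lies on a segment of the first piece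
    exfalso
    have haB := hsub (corner_mem_carrier_of_mem_verts a.2)
    rw [hB, Set.mem_iUnion₂] at haB
    obtain ⟨e₁, ⟨he₁, he₁C⟩, ha₁⟩ := haB
    have ha' := eq_or_eq_of_corner_mem_segment (hE.lattice e₁ he₁) ha₁
    exact he₁C ((hend e₁ he₁ a ha').1 haC)

/-- VERTEX–EDGE COUNT: an admissible edge graph with V lattice vertices has at least V − 1 unit edges
(`cgraph_connected` + Mathlib's «every connected graph on n vertices has at least n − 1 edges»). [cite: Balaban1987RG1, p.257 (linear size d_j, edges of cubes)] -/
theorem card_verts_le_nedges_add_one {X : Finset (Pt d)} {E : List (Pt d × Pt d)} (hE : EAdmissible X E) :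
    (verts E).card ≤ nedges E + 1 := by
  have h := (cgraph_connected hE).card_vert_le_card_edgeSet_add_one
  rw [Nat.card_eq_fintype_card, Fintype.card_coe] at h
  exact h.trans (Nat.add_le_add_right (card_edgeSet_cgraph_le E) 1)

/-! ## §6. Kernel witness: on the 3^d block the two definitions differ (length functional of record, d ≥ 2) -/

/-- THE 3^d BLOCK `B13ScaleTransfer.block c` (all cubes y with |y_i − c_i| ≤ 1) HAS AN ADMISSIBLE EDGE GRAPH (it is a
localization domain: non-empty, and face-connected by `B13ScaleTransfer.linked_block_center` — the landed statement
of the latter is `B14.Eq358ModelInstance.faceConnected_block`, not imported here to keep this module's import closure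
at `TreeLength`). [cite: Balaban1987RG1, p.257 (localization domains)] -/
theorem exists_eAdmissible_block (c : Pt d) : ∃ E, EAdmissible (B13ScaleTransfer.block c) E := by
  obtain ⟨E, hE, -⟩ := exists_eAdmissible (Y := B13ScaleTransfer.block c) ⟨c, mem_block_self c⟩
    fun _ hx _ hy => (linked_block_center hx).symm.trans (linked_block_center hy)
  exact ⟨E, hE⟩

/-- The centre of the middle cube c of the block: (c_i + ½)_i. [cite: Balaban1987RG1, p.257 (linear size d_j, edges of cubes)] -/
def ctr (c : Pt d) : RPt d := fun i => (c i : ℝ) + 1 / 2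

/-- The vertex of the cube c selected by a set S of axes: c_i + 1 for i ∈ S, c_i otherwise. [cite: Balaban1987RG1, p.257 (linear size d_j, edges of cubes)] -/
def vtx (c : Pt d) (S : Finset (Fin d)) : Pt d := fun i => if i ∈ S then c i + 1 else c i

/-- THE STAR: the 2^d segments from the centre of the cube c to its 2^d vertices (a tree graph in the continuous
space, contained in the cube c). [cite: Balaban1987RG1, p.257 (linear size d_j, edges of cubes)] -/
def star (c : Pt d) : List (Seg d) :=
  (Finset.univ : Finset (Finset (Fin d))).toList.map fun S => (ctr c, corner (vtx c S))

/-- `vtx c S` is a vertex of the cube c. [cite: Balaban1987RG1, p.257 (linear size d_j, edges of cubes)] -/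
theorem isVertex_vtx (c : Pt d) (S : Finset (Fin d)) : IsVertex c (vtx c S) := by
  intro i
  by_cases h : i ∈ S
  · right; simp [vtx, h]
  · left; simp [vtx, h]

/-- The centre lies in the cube c. [cite: Balaban1987RG1, p.257 (linear size d_j, edges of cubes)] -/
theorem ctr_mem_cube (c : Pt d) : ctr c ∈ cube c := by
  rw [mem_cube]
  intro i
  simp only [ctr]
  constructor <;> linarith

/-- Each spoke of the star has sup-length ≤ ½ (= ½ when d ≥ 1). [cite: Balaban1987RG1, p.257 (linear size d_j, edges of cubes)] -/
theorem dist_ctr_vtx_le (c : Pt d) (S : Finset (Fin d)) : dist (ctr c) (corner (vtx c S)) ≤ 1 / 2 := by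
  rw [dist_pi_le_iff (by norm_num : (0 : ℝ) ≤ 1 / 2)]
  intro i
  rw [Real.dist_eq]
  simp only [ctr, corner, vtx]
  split_ifs
  · push_cast
    rw [abs_le]
    constructor <;> linarith
  · rw [abs_le]
    constructor <;> linarith

/-- Length of a mapped list of segments with a uniform bound on the segment lengths. [cite: Balaban1987RG1, p.257 (linear size d_j, edges of cubes)] -/
theorem len_map_le {ι : Type*} (l : List ι) (g : ι → Seg d) {b : ℝ} (h : ∀ x ∈ l, dist (g x).1 (g x).2 ≤ b) :
    len (l.map g) ≤ l.length * b := by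
  induction l with
  | nil => simp
  | cons x l ih =>
    rw [List.map_cons, len_cons, List.length_cons]
    have h1 := h x List.mem_cons_self
    have h2 := ih fun y hy => h y (List.mem_cons_of_mem _ hy)
    push_cast
    linarith

/-- THE STAR HAS LENGTH ≤ 2^d / 2 = 2^(d−1) (2^d spokes of sup-length ½). [cite: Balaban1987RG1, p.257 (linear size d_j, edges of cubes)] -/
theorem len_star_le (c : Pt d) : len (star c) ≤ 2 ^ d / 2 := by
  have h := len_map_le (Finset.univ : Finset (Finset (Fin d))).toList (fun S => (ctr c, corner (vtx c S)))
    (b := 1 / 2) fun S _ => dist_ctr_vtx_le c S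
  rw [Finset.length_toList, Finset.card_univ, Fintype.card_finset, Fintype.card_fin] at h
  unfold star
  push_cast at h
  linarith

/-- A graph all of whose segments pass through one point is connected (non-empty list). [cite: Balaban1987RG1, p.257 (linear size d_j, edges of cubes)] -/
theorem isConnected_carrier_of_common_point {T : List (Seg d)} (hT : T ≠ []) {q : RPt d}
    (hq : ∀ s ∈ T, q ∈ segment ℝ s.1 s.2) : IsConnected (carrier T) := by
  induction T with
  | nil => exact absurd rfl hT
  | cons s T ih =>
    rw [carrier_cons]
    by_cases hT' : T = []
    · subst hT'
      rw [carrier_nil, Set.union_empty]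
      exact (convex_segment _ _).isConnected ⟨q, hq s List.mem_cons_self⟩
    · exact IsConnected.union ⟨q, hq s List.mem_cons_self,
          (ih hT' fun s' hs' => hq s' (List.mem_cons_of_mem _ hs')).nonempty.some_mem |> fun _ =>
            by
              obtain ⟨s', hs'⟩ := List.exists_mem_of_ne_nil T hT'
              exact segment_subset_carrier hs' (hq s' (List.mem_cons_of_mem _ hs'))⟩
        ((convex_segment _ _).isConnected ⟨q, hq s List.mem_cons_self⟩)
        (ih hT' fun s' hs' => hq s' (List.mem_cons_of_mem _ hs'))

/-- For a cube y of the block, the vertex of the middle cube c selected by the axes where y_i = c_i + 1 lies in the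
cube y (every cube of the 3^d block touches the middle cube at a vertex). [cite: Balaban1987RG1, p.257 (linear size d_j, edges of cubes)] -/
theorem corner_vtx_mem_cube_of_mem_block {c y : Pt d} (hy : y ∈ B13ScaleTransfer.block c) :
    corner (vtx c (Finset.univ.filter fun i => y i = c i + 1)) ∈ cube y := by
  rw [mem_cube]
  intro i
  obtain ⟨h1, h2⟩ := mem_block.1 hy i
  simp only [corner, vtx, Finset.mem_filter, Finset.mem_univ, true_and]
  split_ifs with h
  · rw [h]
    push_cast
    constructor <;> linarith
  · have h3 : y i ≤ c i := by omega
    have h1' : ((c i : ℤ) : ℝ) - 1 ≤ (y i : ℝ) := by exact_mod_cast h1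
    have h3' : (y i : ℝ) ≤ (c i : ℝ) := by exact_mod_cast h3
    constructor <;> linarith

/-- THE STAR IS ADMISSIBLE FOR THE 3^d BLOCK: connected (all spokes through the centre), inside the cube c, and
meeting every one of the 3^d cubes (at a vertex of the middle cube). [cite: Balaban1987RG1, p.257 (linear size d_j, edges of cubes)] -/
theorem admissible_star (c : Pt d) : Admissible (B13ScaleTransfer.block c) (star c) := by
  have hmem : ∀ s ∈ star c, ∃ S : Finset (Fin d), s = (ctr c, corner (vtx c S)) := by
    intro s hs
    unfold star at hs
    rw [List.mem_map] at hs
    obtain ⟨S, -, rfl⟩ := hs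
    exact ⟨S, rfl⟩
  refine ⟨?_, ?_, ?_⟩
  · refine isConnected_carrier_of_common_point ?_ (q := ctr c) fun s hs => ?_
    · unfold star
      intro h
      rw [List.map_eq_nil_iff, Finset.toList_eq_nil] at h
      exact Finset.univ_nonempty.ne_empty h
    · obtain ⟨S, rfl⟩ := hmem s hs
      exact left_mem_segment ℝ _ _
  · intro p hp
    obtain ⟨s, hs, hps⟩ := mem_carrier.1 hp
    obtain ⟨S, rfl⟩ := hmem s hs
    exact cube_subset_cubes (mem_block_self c)
      ((convex_cube c).segment_subset (ctr_mem_cube c) (corner_mem_cube_of_isVertex (isVertex_vtx c S)) hps)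
  · intro y hy
    refine ⟨corner (vtx c (Finset.univ.filter fun i => y i = c i + 1)), ?_, corner_vtx_mem_cube_of_mem_block hy⟩
    refine segment_subset_carrier (T := star c)
      (s := (ctr c, corner (vtx c (Finset.univ.filter fun i => y i = c i + 1)))) ?_ (right_mem_segment ℝ _ _)
    unfold star
    rw [List.mem_map]
    exact ⟨_, Finset.mem_toList.2 (Finset.mem_univ _), rfl⟩

/-- UPPER BOUND FOR THE CONTINUUM LENGTH OF THE BLOCK: d(block) ≤ 2^d / 2 = 2^(d−1) for the sup-metric `treeLen` of
record (d = 2: ≤ 2; d = 4: ≤ 8). [cite: Balaban1987RG1, p.257 (linear size d_j, edges of cubes)] -/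
theorem treeLen_block_le (c : Pt d) : treeLen (B13ScaleTransfer.block c) ≤ 2 ^ d / 2 :=
  (treeLen_le_len (admissible_star c)).trans (len_star_le c)

/-- The corner cube of the block selected by a set S of axes: c_i + 1 for i ∈ S, c_i − 1 otherwise. [cite: Balaban1987RG1, p.257 (linear size d_j, edges of cubes)] -/
def cornerCube (c : Pt d) (S : Finset (Fin d)) : Pt d := fun i => if i ∈ S then c i + 1 else c i - 1

/-- Corner cubes belong to the block. [cite: Balaban1987RG1, p.257 (localization domains)] -/
theorem cornerCube_mem_block (c : Pt d) (S : Finset (Fin d)) : cornerCube c S ∈ B13ScaleTransfer.block c := by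
  rw [mem_block]
  intro i
  simp only [cornerCube]
  split_ifs <;> omega

/-- DISTINCT CORNER CUBES HAVE DISJOINT VERTEX SETS: a common vertex forces the same set of axes. [cite: Balaban1987RG1, p.257 (linear size d_j, edges of cubes)] -/
theorem eq_of_isVertex_cornerCube {c u : Pt d} {S S' : Finset (Fin d)} (h : IsVertex (cornerCube c S) u)
    (h' : IsVertex (cornerCube c S') u) : S = S' := by
  ext i
  have hi := h i
  have hi' := h' i
  simp only [cornerCube] at hi hi'
  constructor
  · intro hS
    by_contra hS'
    rw [if_pos hS] at hi
    rw [if_neg hS'] at hi'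
    omega
  · intro hS'
    by_contra hS
    rw [if_neg hS] at hi
    rw [if_pos hS'] at hi'
    omega

/-- AN ADMISSIBLE EDGE GRAPH FOR THE BLOCK HAS AT LEAST 2^d LATTICE VERTICES (one vertex in each of the 2^d corner
cubes, pairwise distinct). [cite: Balaban1987RG1, p.257 (linear size d_j, edges of cubes)] -/
theorem two_pow_le_card_verts {c : Pt d} {E : List (Pt d × Pt d)} (hE : EAdmissible (B13ScaleTransfer.block c) E) :
    2 ^ d ≤ (verts E).card := by
  classical
  have hv : ∀ S : Finset (Fin d), ∃ u ∈ verts E, IsVertex (cornerCube c S) u := fun S => by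
    obtain ⟨u, hu, hv, -⟩ := exists_vertex_mem_carrier hE (cornerCube_mem_block c S)
    exact ⟨u, hu, hv⟩
  choose u hu hv using hv
  calc 2 ^ d = (Finset.univ : Finset (Finset (Fin d))).card := by
        rw [Finset.card_univ, Fintype.card_finset, Fintype.card_fin]
    _ ≤ (verts E).card := Finset.card_le_card_of_injOn u (fun S _ => hu S) fun S _ S' _ hSS' =>
        eq_of_isVertex_cornerCube (hv S) (hSS' ▸ hv S')

/-- LOWER BOUND FOR THE EDGE LENGTH OF THE BLOCK: every admissible edge graph for the 3^d block has at least 2^d − 1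
unit edges, hence 2^d ≤ edgeLen (B13ScaleTransfer.block c) + 1 (d = 2: edgeLen ≥ 3; d = 4: edgeLen ≥ 15). [cite: Balaban1987RG1, p.257 (linear size d_j, edges of cubes)] -/
theorem two_pow_le_edgeLen_block_add_one (c : Pt d) : 2 ^ d ≤ edgeLen (B13ScaleTransfer.block c) + 1 := by
  obtain ⟨E, hE, hn⟩ := exists_eAdmissible_nedges_eq (exists_eAdmissible_block c)
  rw [← hn]
  exact (two_pow_le_card_verts hE).trans (card_verts_le_nedges_add_one hE)

/-- THE TWO DEFINITIONS DIFFER (cell GAPS.md G-B12-08): for every d ≥ 2 and the 3^d block,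
treeLen (B13ScaleTransfer.block c) ≤ 2^(d−1) < 2^d − 1 ≤ edgeLen (B13ScaleTransfer.block c) — «the shortest tree graphs formed by edges of cubes» are
STRICTLY LONGER than the shortest tree graphs in the continuous space, for the (sup-metric) length functional of
`TreeLength`; so the printed «equivalent definition» holds up to the constants of `edgeLen_le_affine_treeLen`, not
literally. [cite: Balaban1987RG1, p.257 (linear size d_j, edges of cubes)] -/
theorem treeLen_block_lt_edgeLen_block (hd : 2 ≤ d) (c : Pt d) : treeLen (B13ScaleTransfer.block c) < (edgeLen (B13ScaleTransfer.block c) : ℝ) := by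
  have h1 := treeLen_block_le c
  have h2 : ((2 ^ d : ℕ) : ℝ) ≤ ((edgeLen (B13ScaleTransfer.block c) + 1 : ℕ) : ℝ) := by
    exact_mod_cast two_pow_le_edgeLen_block_add_one c
  push_cast at h2
  have h4 : (4 : ℝ) ≤ 2 ^ d := by
    have : (2 : ℝ) ^ 2 ≤ 2 ^ d := pow_le_pow_right₀ (by norm_num) hd
    norm_num at this
    exact this
  linarith

/-- d = 2, the 3 × 3 block: d(X) ≤ 2 < 3 ≤ edgeLen X. [cite: Balaban1987RG1, p.257 (linear size d_j, edges of cubes)] -/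
theorem block_two (c : Pt 2) : treeLen (B13ScaleTransfer.block c) ≤ 2 ∧ 3 ≤ edgeLen (B13ScaleTransfer.block c) := by
  refine ⟨by have := treeLen_block_le c; norm_num at this; exact this, ?_⟩
  have := two_pow_le_edgeLen_block_add_one c
  norm_num at this
  omega

/-- d = 4 (the paper's dimension), the 3⁴ block of 81 cubes: d(X) ≤ 8 < 15 ≤ edgeLen X. [cite: Balaban1987RG1, p.257 (linear size d_j, edges of cubes)] -/
theorem block_four (c : Pt 4) : treeLen (B13ScaleTransfer.block c) ≤ 8 ∧ 15 ≤ edgeLen (B13ScaleTransfer.block c) := by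
  refine ⟨by have := treeLen_block_le c; norm_num at this; exact this, ?_⟩
  have := two_pow_le_edgeLen_block_add_one c
  norm_num at this
  omega

/-! ## §7. The exact edge length of the block: edgeLen (block c) + 1 = 2^d (a spanning tree of the middle cube's
vertices along cube edges) -/

/-- Parent of a set of axes in the binary spanning tree: remove the least axis (the empty set is its own parent). [cite: Balaban1987RG1, p.257 (linear size d_j, edges of cubes)] -/
def parent (S : Finset (Fin d)) : Finset (Fin d) := if h : S.Nonempty then S.erase (S.min' h) else S

/-- The tree edge of S: from the vertex of `parent S` to the vertex of S of the cube c (degenerate for S = ∅). [cite: Balaban1987RG1, p.257 (linear size d_j, edges of cubes)] -/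
def treeEdge (c : Pt d) (S : Finset (Fin d)) : Pt d × Pt d := (vtx c (parent S), vtx c S)

/-- THE CUBE TREE: the 2^d − 1 edges `treeEdge c S`, S ≠ ∅, of the cube c (a spanning tree of its vertex set along
cube edges) together with the vertex c itself (S = ∅). [cite: Balaban1987RG1, p.257 (linear size d_j, edges of cubes)] -/
def cubeTree (c : Pt d) : List (Pt d × Pt d) :=
  (Finset.univ : Finset (Finset (Fin d))).toList.map (treeEdge c)

/-- For S ≠ ∅ the tree edge is an upward unit edge along the least axis of S. [cite: Balaban1987RG1, p.257 (linear size d_j, edges of cubes)] -/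
theorem isUpEdge_treeEdge (c : Pt d) {S : Finset (Fin d)} (hS : S.Nonempty) :
    IsUpEdge (vtx c (parent S)) (vtx c S) := by
  refine ⟨S.min' hS, ?_⟩
  funext j
  unfold parent
  rw [dif_pos hS]
  by_cases hj : j = S.min' hS
  · subst hj
    rw [Function.update_self]
    simp [vtx, Finset.min'_mem]
  · rw [Function.update_of_ne hj]
    simp [vtx, Finset.mem_erase, hj]

/-- Every member of the cube tree is a lattice pair of vertices of the cube c. [cite: Balaban1987RG1, p.257 (linear size d_j, edges of cubes)] -/
theorem isLatticePair_treeEdge (c : Pt d) (S : Finset (Fin d)) : IsLatticePair (vtx c (parent S)) (vtx c S) := by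
  by_cases hS : S.Nonempty
  · exact Or.inr (isUpEdge_treeEdge c hS).adj
  · left
    unfold parent
    rw [dif_neg hS]

/-- The carrier of the cube tree is the union of its 2^d segments. [cite: Balaban1987RG1, p.257 (linear size d_j, edges of cubes)] -/
theorem carrier_cubeTree (c : Pt d) :
    carrier (toSegs (cubeTree c)) = ⋃ S : Finset (Fin d), segment ℝ (corner (vtx c (parent S))) (corner (vtx c S)) := by
  ext p
  rw [mem_carrier, Set.mem_iUnion]
  unfold toSegs cubeTree
  simp only [List.map_map, List.mem_map, Finset.mem_toList, Finset.mem_univ, true_and, Function.comp_apply]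
  constructor
  · rintro ⟨s, ⟨S, rfl⟩, hp⟩
    exact ⟨S, hp⟩
  · rintro ⟨S, hp⟩
    exact ⟨_, ⟨S, rfl⟩, hp⟩

/-- The intersection pattern of the tree segments: the segments of S and S′ meet. [cite: Balaban1987RG1, p.257 (linear size d_j, edges of cubes)] -/
def TreeRel (c : Pt d) (S S' : Finset (Fin d)) : Prop :=
  (segment ℝ (corner (vtx c (parent S))) (corner (vtx c S)) ∩
    segment ℝ (corner (vtx c (parent S'))) (corner (vtx c S'))).Nonempty

/-- The intersection pattern is symmetric. [cite: Balaban1987RG1, p.257 (linear size d_j, edges of cubes)] -/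
theorem treeRel_symm (c : Pt d) {S S' : Finset (Fin d)} (h : TreeRel c S S') : TreeRel c S' S := by
  unfold TreeRel at h ⊢
  rwa [Set.inter_comm]

/-- Every set of axes is linked to ∅ and back along the parent chain, consecutive tree segments sharing a vertex. [cite: Balaban1987RG1, p.257 (linear size d_j, edges of cubes)] -/
theorem reflTransGen_parent_chain (c : Pt d) : ∀ n : ℕ, ∀ S : Finset (Fin d), S.card = n →
    Relation.ReflTransGen (TreeRel c) S ∅ ∧ Relation.ReflTransGen (TreeRel c) ∅ S := by
  intro n
  induction n with
  | zero =>
    intro S hS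
    rw [Finset.card_eq_zero] at hS
    subst hS
    exact ⟨Relation.ReflTransGen.refl, Relation.ReflTransGen.refl⟩
  | succ n ih =>
    intro S hS
    have hne : S.Nonempty := by
      rw [← Finset.card_pos, hS]
      exact Nat.succ_pos n
    have hcard : (parent S).card = n := by
      unfold parent
      rw [dif_pos hne, Finset.card_erase_of_mem (Finset.min'_mem S hne), hS]
      rfl
    -- one step S ↔ parent S (they share the vertex `vtx c (parent S)`), then the chain of parent S
    have hstep : TreeRel c S (parent S) :=
      ⟨corner (vtx c (parent S)), left_mem_segment ℝ _ _, right_mem_segment ℝ _ _⟩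
    obtain ⟨h1, h2⟩ := ih (parent S) hcard
    exact ⟨Relation.ReflTransGen.head hstep h1, Relation.ReflTransGen.tail h2 (treeRel_symm c hstep)⟩

/-- THE CUBE TREE IS CONNECTED (union of segments indexed by a connected intersection pattern). [cite: Balaban1987RG1, p.257 (linear size d_j, edges of cubes)] -/
theorem isConnected_carrier_cubeTree (c : Pt d) : IsConnected (carrier (toSegs (cubeTree c))) := by
  rw [carrier_cubeTree]
  refine IsConnected.iUnion_of_reflTransGen (fun S => (convex_segment _ _).isConnected ⟨_, left_mem_segment ℝ _ _⟩)
    fun S S' => ?_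
  exact (reflTransGen_parent_chain c _ S rfl).1.trans (reflTransGen_parent_chain c _ S' rfl).2

/-- THE CUBE TREE IS AN ADMISSIBLE EDGE GRAPH FOR THE 3^d BLOCK. [cite: Balaban1987RG1, p.257 (linear size d_j, edges of cubes)] -/
theorem eAdmissible_cubeTree (c : Pt d) : EAdmissible (B13ScaleTransfer.block c) (cubeTree c) := by
  have hmem : ∀ e ∈ cubeTree c, ∃ S : Finset (Fin d), e = treeEdge c S := by
    intro e he
    unfold cubeTree at he
    rw [List.mem_map] at he
    obtain ⟨S, -, rfl⟩ := he
    exact ⟨S, rfl⟩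
  refine ⟨?_, ?_, ⟨isConnected_carrier_cubeTree c, ?_, ?_⟩⟩
  · intro e he
    obtain ⟨S, rfl⟩ := hmem e he
    exact isLatticePair_treeEdge c S
  · intro e he
    obtain ⟨S, rfl⟩ := hmem e he
    exact ⟨c, mem_block_self c, isVertex_vtx c _, isVertex_vtx c _⟩
  · intro p hp
    obtain ⟨s, hs, hps⟩ := mem_carrier.1 hp
    obtain ⟨e, he, rfl⟩ := List.mem_map.1 hs
    obtain ⟨S, rfl⟩ := hmem e he
    exact cube_subset_cubes (mem_block_self c) ((convex_cube c).segment_subset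
      (corner_mem_cube_of_isVertex (isVertex_vtx c _)) (corner_mem_cube_of_isVertex (isVertex_vtx c _)) hps)
  · intro y hy
    refine ⟨corner (vtx c (Finset.univ.filter fun i => y i = c i + 1)), ?_, corner_vtx_mem_cube_of_mem_block hy⟩
    refine segment_subset_carrier (T := toSegs (cubeTree c))
      (s := seg (treeEdge c (Finset.univ.filter fun i => y i = c i + 1))) ?_ (right_mem_segment ℝ _ _)
    unfold toSegs cubeTree
    rw [List.map_map, List.mem_map]
    exact ⟨_, Finset.mem_toList.2 (Finset.mem_univ _), rfl⟩

/-- The cube tree has at most 2^d − 1 unit edges (its member for S = ∅ is a vertex). [cite: Balaban1987RG1, p.257 (linear size d_j, edges of cubes)] -/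
theorem nedges_cubeTree_add_one_le (c : Pt d) : nedges (cubeTree c) + 1 ≤ 2 ^ d := by
  have hlen : (cubeTree c).length = 2 ^ d := by
    unfold cubeTree
    rw [List.length_map, Finset.length_toList, Finset.card_univ, Fintype.card_finset, Fintype.card_fin]
  have hlt : nedges (cubeTree c) < (cubeTree c).length := by
    unfold nedges
    rw [List.length_filter_lt_length_iff_exists]
    refine ⟨treeEdge c ∅, ?_, ?_⟩
    · unfold cubeTree
      rw [List.mem_map]
      exact ⟨∅, Finset.mem_toList.2 (Finset.mem_univ _), rfl⟩
    · simp [treeEdge, parent]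
  omega

/-- THE EXACT EDGE LENGTH OF THE BLOCK: edgeLen (block c) + 1 = 2^d (d = 2: edgeLen = 3; d = 4: edgeLen = 15) — the
lower bound of §6 is attained by the cube tree. [cite: Balaban1987RG1, p.257 (linear size d_j, edges of cubes)] -/
theorem edgeLen_block_add_one (c : Pt d) : edgeLen (B13ScaleTransfer.block c) + 1 = 2 ^ d :=
  le_antisymm
    ((Nat.add_le_add_right (edgeLen_le_nedges (eAdmissible_cubeTree c)) 1).trans (nedges_cubeTree_add_one_le c))
    (two_pow_le_edgeLen_block_add_one c)

/-! ## §8. Volume bound for the edge length: |X| ≤ 2^d·(edgeLen X + 1) (each lattice vertex is a vertex of 2^d cubes) -/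

/-- The 2^d cubes having the lattice point u as a vertex: indices x with x_i ∈ {u_i − 1, u_i}. [cite: Balaban1987RG1, p.257 (linear size d_j, edges of cubes)] -/
def cubesAt (u : Pt d) : Finset (Pt d) := Fintype.piFinset fun i => ({u i - 1, u i} : Finset ℤ)

/-- x ∈ `cubesAt u` iff u is a vertex of the cube x. [cite: Balaban1987RG1, p.257 (linear size d_j, edges of cubes)] -/
theorem mem_cubesAt {u x : Pt d} : x ∈ cubesAt u ↔ IsVertex x u := by
  unfold cubesAt IsVertex
  rw [Fintype.mem_piFinset]
  refine forall_congr' fun i => ?_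
  rw [Finset.mem_insert, Finset.mem_singleton]
  omega

/-- A lattice point is a vertex of at most (in fact exactly) 2^d cubes. [cite: Balaban1987RG1, p.257 (linear size d_j, edges of cubes)] -/
theorem card_cubesAt_le (u : Pt d) : (cubesAt u).card ≤ 2 ^ d := by
  unfold cubesAt
  rw [Fintype.card_piFinset]
  calc ∏ i, ({u i - 1, u i} : Finset ℤ).card ≤ ∏ _i : Fin d, 2 :=
        Finset.prod_le_prod' fun i _ => Finset.card_le_two
    _ = 2 ^ d := by rw [Finset.prod_const, Finset.card_univ, Fintype.card_fin]

/-- An admissible edge graph with V lattice vertices meets at most 2^d·V cubes, so |X| ≤ 2^d·V. [cite: Balaban1987RG1, p.257 (linear size d_j, edges of cubes)] -/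
theorem card_le_two_pow_mul_card_verts {X : Finset (Pt d)} {E : List (Pt d × Pt d)} (hE : EAdmissible X E) :
    X.card ≤ 2 ^ d * (verts E).card := by
  classical
  have hsub : X ⊆ (verts E).biUnion cubesAt := by
    intro x hx
    obtain ⟨u, hu, hv, -⟩ := exists_vertex_mem_carrier hE hx
    exact Finset.mem_biUnion.2 ⟨u, hu, mem_cubesAt.2 hv⟩
  calc X.card ≤ ((verts E).biUnion cubesAt).card := Finset.card_le_card hsub
    _ ≤ ∑ u ∈ verts E, (cubesAt u).card := Finset.card_biUnion_le
    _ ≤ ∑ _u ∈ verts E, 2 ^ d := Finset.sum_le_sum fun u _ => card_cubesAt_le u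
    _ = 2 ^ d * (verts E).card := by rw [Finset.sum_const, smul_eq_mul, mul_comm]

/-- VOLUME BOUND FOR THE EDGE LENGTH: |Y| ≤ 2^d·(edgeLen Y + 1) for every localization domain Y — the edge-length
analogue of the (repaired) lower half of [Balaban1988RG2Cluster] (2.30) (`TreeLength.card_le_treeLen`: |Y| ≤
2^d(4·d(Y) + 1) for the continuum length), with the smaller constant because an edge graph meets cubes only at its
lattice vertices. [cite: Balaban1987RG1, p.257 (linear size d_j, edges of cubes)] -/
theorem card_le_two_pow_mul_edgeLen_add_one {Y : Finset (Pt d)} (hY : Y.Nonempty) (hc : FaceConnected Y) :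
    Y.card ≤ 2 ^ d * (edgeLen Y + 1) := by
  obtain ⟨E, hE, hn⟩ := exists_eAdmissible_nedges_eq
    (X := Y) (let ⟨E, hE, _⟩ := exists_eAdmissible hY hc; ⟨E, hE⟩)
  rw [← hn]
  exact (card_le_two_pow_mul_card_verts hE).trans (Nat.mul_le_mul_left _ (card_verts_le_nedges_add_one hE))

/-- Two-sided placement of the edge length among |Y|: (|Y|/2^d) − 1 ≤ edgeLen Y ≤ |Y| − 1. [cite: Balaban1987RG1, p.257 (linear size d_j, edges of cubes)] -/
theorem edgeLen_bounds_card {Y : Finset (Pt d)} (hY : Y.Nonempty) (hc : FaceConnected Y) :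
    Y.card ≤ 2 ^ d * (edgeLen Y + 1) ∧ edgeLen Y + 1 ≤ Y.card :=
  ⟨card_le_two_pow_mul_edgeLen_add_one hY hc, edgeLen_add_one_le_card hY hc⟩

/-! ## §9. Edge length zero: exactly when the cubes of the domain have a common vertex -/

/-- The one-vertex graph [(u, u)] is an admissible edge graph for any non-empty family of cubes all having u as a
vertex (0 unit edges). [cite: Balaban1987RG1, p.257 (linear size d_j, edges of cubes)] -/
theorem eAdmissible_vertex {Y : Finset (Pt d)} (hY : Y.Nonempty) {u : Pt d} (hu : ∀ x ∈ Y, IsVertex x u) :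
    EAdmissible Y [(u, u)] := by
  obtain ⟨x₀, hx₀⟩ := hY
  refine ⟨?_, ?_, ⟨?_, ?_, ?_⟩⟩
  · intro e he
    rw [List.mem_singleton] at he
    subst he
    exact Or.inl rfl
  · intro e he
    rw [List.mem_singleton] at he
    subst he
    exact ⟨x₀, hx₀, hu x₀ hx₀, hu x₀ hx₀⟩
  · simp only [toSegs_cons, toSegs_nil, carrier_cons, carrier_nil, Set.union_empty, segment_same]
    exact isConnected_singleton
  · simp only [toSegs_cons, toSegs_nil, carrier_cons, carrier_nil, Set.union_empty, segment_same,
      Set.singleton_subset_iff]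
    exact cube_subset_cubes hx₀ (corner_mem_cube_of_isVertex (hu x₀ hx₀))
  · intro x hx
    refine ⟨corner u, ?_, corner_mem_cube_of_isVertex (hu x hx)⟩
    simp only [toSegs_cons, toSegs_nil, carrier_cons, carrier_nil, Set.union_empty, segment_same,
      Set.mem_singleton_iff]

/-- EDGE LENGTH ZERO ⇔ COMMON VERTEX: for a localization domain Y, edgeLen Y = 0 iff some lattice point is a vertex
of every cube of Y (⇒: a shortest edge graph with no unit edge has a single lattice vertex, §5, and meets every cube
at one of its vertices, §4). [cite: Balaban1987RG1, p.257 (linear size d_j, edges of cubes)] -/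
theorem edgeLen_eq_zero_iff {Y : Finset (Pt d)} (hY : Y.Nonempty) (hc : FaceConnected Y) :
    edgeLen Y = 0 ↔ ∃ u : Pt d, ∀ x ∈ Y, IsVertex x u := by
  constructor
  · intro h0
    obtain ⟨E, hE, hn⟩ := exists_eAdmissible_nedges_eq
      (X := Y) (let ⟨E, hE, _⟩ := exists_eAdmissible hY hc; ⟨E, hE⟩)
    rw [h0] at hn
    have hcard : (verts E).card ≤ 1 := by
      have := card_verts_le_nedges_add_one hE
      omega
    obtain ⟨x₀, hx₀⟩ := hY
    obtain ⟨u, hu, -, -⟩ := exists_vertex_mem_carrier hE hx₀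
    refine ⟨u, fun x hx => ?_⟩
    obtain ⟨u', hu', hv', -⟩ := exists_vertex_mem_carrier hE hx
    have : u' = u := Finset.card_le_one.1 hcard u' hu' u hu
    rw [← this]
    exact hv'
  · rintro ⟨u, hu⟩
    have := edgeLen_le_nedges (eAdmissible_vertex hY hu)
    simp only [nedges_cons, nedges_nil, if_true, add_zero] at this
    omega

/-- In particular a single cube and a pair of cubes with a common wall have edge length 0 (they share a vertex),
while the 3^d block has edge length 2^d − 1 (§7). [cite: Balaban1987RG1, p.257 (linear size d_j, edges of cubes)] -/
theorem edgeLen_singleton (x : Pt d) : edgeLen ({x} : Finset (Pt d)) = 0 := by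
  have := edgeLen_le_nedges (eAdmissible_singleton x)
  simp only [nedges_cons, nedges_nil, if_true, add_zero] at this
  omega

/-! ## §10. Linear size zero: both definitions vanish exactly when the cubes of the domain have a common vertex;
otherwise the continuum length is already ≥ 1 (so the two lengths agree on {d = 0}, where they differ least) -/

/-- HELLY FOR LATTICE CUBES: the cubes of a non-empty family have a common vertex iff their indices differ by at most
1 in every coordinate, pairwise (the common vertex is then the coordinatewise maximum of the indices). [cite: Balaban1987RG1, p.257 (linear size d_j, edges of cubes)] -/
theorem exists_common_vertex_iff {Y : Finset (Pt d)} (hY : Y.Nonempty) :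
    (∃ u : Pt d, ∀ x ∈ Y, IsVertex x u) ↔ ∀ x ∈ Y, ∀ y ∈ Y, ∀ i, x i ≤ y i + 1 := by
  constructor
  · rintro ⟨u, hu⟩ x hx y hy i
    rcases hu x hx i with h | h <;> rcases hu y hy i with h' | h' <;> omega
  · intro h
    refine ⟨fun i => Y.sup' hY (fun x => x i), fun x hx i => ?_⟩
    have h1 : x i ≤ Y.sup' hY (fun x => x i) := Finset.le_sup' (fun x => x i) hx
    have h2 : Y.sup' hY (fun x => x i) ≤ x i + 1 := Finset.sup'_le hY _ fun y hy => h y hy x hx i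
    show Y.sup' hY (fun x => x i) = x i ∨ Y.sup' hY (fun x => x i) = x i + 1
    omega

/-- A COORDINATE GAP ≥ 2 between two cubes of a localization domain forces d(Y) ≥ 1: every admissible graph meets
both cubes, at points p, q with |p_i − q_i| ≥ 1, and a connected polygonal graph through p reaching sup-distance 1
has length ≥ 1 (`TreeLength.le_lenIn_closedBall`, the capture lemma, + `sum_lenIn_le_len`). [cite: Balaban1987RG1, p.257 (linear size d_j, edges of cubes)] -/
theorem one_le_treeLen_of_gap {Y : Finset (Pt d)} (hY : Y.Nonempty) (hc : FaceConnected Y) {x y : Pt d}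
    (hx : x ∈ Y) (hy : y ∈ Y) {i : Fin d} (h : x i + 2 ≤ y i) : 1 ≤ treeLen Y := by
  obtain ⟨T₀, hT₀, -⟩ := exists_admissible hY hc
  refine le_treeLen ⟨T₀, hT₀⟩ fun T hT => ?_
  obtain ⟨p, hpT, hpx⟩ := hT.meets x hx
  obtain ⟨q, hqT, hqy⟩ := hT.meets y hy
  have hpq : 1 ≤ dist p q := by
    have hp := ((mem_cube.1 hpx) i).2
    have hq := ((mem_cube.1 hqy) i).1
    have h' : (x i : ℝ) + 2 ≤ (y i : ℝ) := by exact_mod_cast h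
    calc (1 : ℝ) ≤ q i - p i := by linarith
      _ ≤ |p i - q i| := by rw [abs_sub_comm]; exact le_abs_self _
      _ = dist (p i) (q i) := (Real.dist_eq _ _).symm
      _ ≤ dist p q := dist_le_pi_dist p q i
  have h1 := le_lenIn_closedBall hT.connected.isPreconnected hpT hqT one_pos hpq
  have h2 : lenIn (Metric.closedBall p 1) T ≤ len T := by
    have := sum_lenIn_le_len ({0} : Finset ℕ) (fun _ => Metric.closedBall p 1)
      (fun _ _ => Metric.isClosed_closedBall) (by simp) T
    simpa using this
  linarith

/-- DICHOTOMY FOR THE CONTINUUM LENGTH (sup metric of record): either the cubes of the localization domain have a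
common vertex and d(Y) = 0, or d(Y) ≥ 1 — there is no localization domain with 0 < d(Y) < 1. [cite: Balaban1987RG1, p.257 (linear size d_j, edges of cubes)] -/
theorem treeLen_eq_zero_or_one_le {Y : Finset (Pt d)} (hY : Y.Nonempty) (hc : FaceConnected Y) :
    ((∃ u : Pt d, ∀ x ∈ Y, IsVertex x u) ∧ treeLen Y = 0) ∨ 1 ≤ treeLen Y := by
  by_cases h : ∀ x ∈ Y, ∀ y ∈ Y, ∀ i, x i ≤ y i + 1
  · left
    obtain ⟨u, hu⟩ := (exists_common_vertex_iff hY).2 h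
    refine ⟨⟨u, hu⟩, le_antisymm ?_ (treeLen_nonneg Y)⟩
    have := treeLen_le_len (eAdmissible_vertex hY hu).admissible
    simpa [toSegs_cons, toSegs_nil] using this
  · right
    push Not at h
    obtain ⟨x, hx, y, hy, i, hlt⟩ := h
    exact one_le_treeLen_of_gap hY hc hy hx (i := i) (by omega)

/-- d(Y) = 0 ⇔ THE CUBES OF Y HAVE A COMMON VERTEX (localization domains; sup-metric `treeLen`). [cite: Balaban1987RG1, p.257 (linear size d_j, edges of cubes)] -/
theorem treeLen_eq_zero_iff {Y : Finset (Pt d)} (hY : Y.Nonempty) (hc : FaceConnected Y) :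
    treeLen Y = 0 ↔ ∃ u : Pt d, ∀ x ∈ Y, IsVertex x u := by
  constructor
  · intro h0
    rcases treeLen_eq_zero_or_one_le hY hc with ⟨hu, -⟩ | h1
    · exact hu
    · exfalso
      rw [h0] at h1
      exact absurd h1 (by norm_num)
  · intro hu
    rcases treeLen_eq_zero_or_one_le hY hc with ⟨-, h0⟩ | h1
    · exact h0
    · -- a common vertex gives an admissible one-point graph of length 0
      obtain ⟨u, hu⟩ := hu
      refine le_antisymm ?_ (treeLen_nonneg Y)
      have := treeLen_le_len (eAdmissible_vertex hY hu).admissible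
      simpa [toSegs_cons, toSegs_nil] using this

/-- THE TWO DEFINITIONS AGREE ON LINEAR SIZE ZERO: d(Y) = 0 ⇔ edgeLen Y = 0 (both ⇔ a common vertex of all cubes,
`treeLen_eq_zero_iff` and §9 `edgeLen_eq_zero_iff`) — in contrast with §6, where they differ on the 3^d block. [cite: Balaban1987RG1, p.257 (linear size d_j, edges of cubes)] -/
theorem treeLen_eq_zero_iff_edgeLen_eq_zero {Y : Finset (Pt d)} (hY : Y.Nonempty) (hc : FaceConnected Y) :
    treeLen Y = 0 ↔ edgeLen Y = 0 :=
  (treeLen_eq_zero_iff hY hc).trans (edgeLen_eq_zero_iff hY hc).symm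

/-- POSITIVE LINEAR SIZES ARE AT LEAST 1: 0 < d(Y) ⇒ 1 ≤ d(Y) ≤ edgeLen Y. [cite: Balaban1987RG1, p.257 (linear size d_j, edges of cubes)] -/
theorem one_le_treeLen_of_pos {Y : Finset (Pt d)} (hY : Y.Nonempty) (hc : FaceConnected Y) (h : 0 < treeLen Y) :
    1 ≤ treeLen Y ∧ (1 : ℝ) ≤ edgeLen Y := by
  rcases treeLen_eq_zero_or_one_le hY hc with ⟨-, h0⟩ | h1
  · exact absurd h0 (ne_of_gt h)
  · exact ⟨h1, h1.trans (treeLen_le_edgeLen_of_faceConnected hY hc)⟩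

/-! ## §11. The Euclidean reading: on the 3 × 3 block the two definitions differ for the Euclidean length as well
(two diagonals of the middle square, 2√2 < 3); only the ℓ¹ reading is left open by this file -/

/-- The Euclidean distance of two points of ℝ^d (the default reading of «a length … in the continuous space»;
`TreeLength`'s `dist` is the sup metric). [cite: Balaban1987RG1, p.257 (linear size d_j, edges of cubes)] -/
def edist2 (p q : RPt d) : ℝ := Real.sqrt (∑ i, (p i - q i) ^ 2)

/-- The Euclidean length of a polygonal graph: the sum of the Euclidean lengths of its segments. [cite: Balaban1987RG1, p.257 (linear size d_j, edges of cubes)] -/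
def elen : List (Seg d) → ℝ
  | [] => 0
  | s :: T => edist2 s.1 s.2 + elen T

/-- Euclidean length of the empty graph. [cite: Balaban1987RG1, p.257 (linear size d_j, edges of cubes)] -/
@[simp] theorem elen_nil : elen ([] : List (Seg d)) = 0 := rfl

/-- Euclidean length of a graph with one more segment. [cite: Balaban1987RG1, p.257 (linear size d_j, edges of cubes)] -/
@[simp] theorem elen_cons (s : Seg d) (T : List (Seg d)) : elen (s :: T) = edist2 s.1 s.2 + elen T := rfl

/-- The Euclidean distance is symmetric. [cite: Balaban1987RG1, p.257 (linear size d_j, edges of cubes)] -/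
theorem edist2_comm (p q : RPt d) : edist2 p q = edist2 q p := by
  unfold edist2
  congr 1
  exact Finset.sum_congr rfl fun i _ => by ring

/-- A UNIT EDGE HAS EUCLIDEAN LENGTH 1 (upward orientation). [cite: Balaban1987RG1, p.257 (linear size d_j, edges of cubes)] -/
theorem edist2_corner_of_isUpEdge {v w : Pt d} (h : IsUpEdge v w) : edist2 (corner v) (corner w) = 1 := by
  obtain ⟨i, hi, hj⟩ := h.coord
  unfold edist2
  rw [Real.sqrt_eq_one]
  rw [Finset.sum_eq_single i]
  · simp only [corner, hi, Int.cast_add, Int.cast_one]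
    ring
  · intro j _ hji
    simp only [corner, hj j hji]
    ring
  · intro hi'
    exact absurd (Finset.mem_univ i) hi'

/-- The Euclidean length of the segment of a lattice pair: 0 for a vertex, 1 for a unit edge — the SAME as its
sup-metric length (`dist_seg_of_isLatticePair`). [cite: Balaban1987RG1, p.257 (linear size d_j, edges of cubes)] -/
theorem edist2_seg_of_isLatticePair {v w : Pt d} (h : IsLatticePair v w) :
    edist2 (corner v) (corner w) = if v = w then 0 else 1 := by
  split_ifs with hvw
  · subst hvw
    unfold edist2
    simp
  · rcases h with h | h
    · exact absurd h hvw
    · rcases adj_iff_isUpEdge.1 h with h | h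
      · exact edist2_corner_of_isUpEdge h
      · rw [edist2_comm]
        exact edist2_corner_of_isUpEdge h

/-- THE EUCLIDEAN LENGTH OF AN EDGE GRAPH IS ITS NUMBER OF UNIT EDGES (as for the sup metric, `len_toSegs`: the edge
length `edgeLen` does not depend on the metric convention). [cite: Balaban1987RG1, p.257 (linear size d_j, edges of cubes)] -/
theorem elen_toSegs {E : List (Pt d × Pt d)} (h : ∀ e ∈ E, IsLatticePair e.1 e.2) :
    elen (toSegs E) = (nedges E : ℝ) := by
  induction E with
  | nil => simp
  | cons e E ih =>
    rw [toSegs_cons, elen_cons, nedges_cons, ih fun e' he' => h e' (List.mem_cons_of_mem _ he')]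
    change edist2 (corner e.1) (corner e.2) + _ = _
    rw [edist2_seg_of_isLatticePair (h e List.mem_cons_self)]
    split_ifs <;> push_cast <;> ring

/-- THE CROSS: the two diagonals of the middle square of the 3 × 3 block (d = 2), a tree graph in the continuous
space through the centre of the square. [cite: Balaban1987RG1, p.257 (linear size d_j, edges of cubes)] -/
def cross (c : Pt 2) : List (Seg 2) :=
  [(corner (vtx c ∅), corner (vtx c Finset.univ)), (corner (vtx c {0}), corner (vtx c {1}))]

/-- The centre of the square lies on both diagonals. [cite: Balaban1987RG1, p.257 (linear size d_j, edges of cubes)] -/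
theorem ctr_mem_of_mem_cross (c : Pt 2) : ∀ s ∈ cross c, ctr c ∈ segment ℝ s.1 s.2 := by
  intro s hs
  simp only [cross, List.mem_cons, List.mem_nil_iff, or_false] at hs
  rcases hs with rfl | rfl
  · refine ⟨1 / 2, 1 / 2, by norm_num, by norm_num, by norm_num, ?_⟩
    funext i
    simp only [Pi.add_apply, Pi.smul_apply, smul_eq_mul, corner, vtx, ctr, Finset.notMem_empty, if_false,
      Finset.mem_univ, if_true, Int.cast_add, Int.cast_one]
    ring
  · refine ⟨1 / 2, 1 / 2, by norm_num, by norm_num, by norm_num, ?_⟩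
    funext i
    simp only [Pi.add_apply, Pi.smul_apply, smul_eq_mul, corner, vtx, ctr, Finset.mem_singleton]
    fin_cases i <;> simp <;> ring

/-- Every subset of the two axes is ∅, {0}, {1} or everything. [cite: Balaban1987RG1, p.257 (linear size d_j, edges of cubes)] -/
theorem finset_fin_two_cases (S : Finset (Fin 2)) : S = ∅ ∨ S = Finset.univ ∨ S = {0} ∨ S = {1} := by
  revert S
  decide

/-- THE CROSS IS ADMISSIBLE FOR THE 3 × 3 BLOCK: connected (through the centre), inside the middle square, and meeting
all 9 squares (its four endpoints are the four vertices of the middle square, and every square of the block has one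
of them as a vertex). [cite: Balaban1987RG1, p.257 (linear size d_j, edges of cubes)] -/
theorem admissible_cross (c : Pt 2) : Admissible (B13ScaleTransfer.block c) (cross c) := by
  have hends : ∀ S : Finset (Fin 2), ∃ s ∈ cross c, corner (vtx c S) = s.1 ∨ corner (vtx c S) = s.2 := by
    intro S
    rcases finset_fin_two_cases S with rfl | rfl | rfl | rfl
    · exact ⟨_, List.mem_cons_self, Or.inl rfl⟩
    · exact ⟨_, List.mem_cons_self, Or.inr rfl⟩
    · exact ⟨_, List.mem_cons_of_mem _ List.mem_cons_self, Or.inl rfl⟩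
    · exact ⟨_, List.mem_cons_of_mem _ List.mem_cons_self, Or.inr rfl⟩
  have hsegs : ∀ s ∈ cross c, ∃ S S' : Finset (Fin 2), s = (corner (vtx c S), corner (vtx c S')) := by
    intro s hs
    simp only [cross, List.mem_cons, List.mem_nil_iff, or_false] at hs
    rcases hs with rfl | rfl
    · exact ⟨_, _, rfl⟩
    · exact ⟨_, _, rfl⟩
  refine ⟨isConnected_carrier_of_common_point (by simp [cross]) (ctr_mem_of_mem_cross c), ?_, ?_⟩
  · intro p hp
    obtain ⟨s, hs, hps⟩ := mem_carrier.1 hp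
    obtain ⟨S, S', rfl⟩ := hsegs s hs
    exact cube_subset_cubes (mem_block_self c) ((convex_cube c).segment_subset
      (corner_mem_cube_of_isVertex (isVertex_vtx c S)) (corner_mem_cube_of_isVertex (isVertex_vtx c S')) hps)
  · intro y hy
    obtain ⟨s, hs, hend⟩ := hends (Finset.univ.filter fun i => y i = c i + 1)
    refine ⟨corner (vtx c (Finset.univ.filter fun i => y i = c i + 1)), ?_, corner_vtx_mem_cube_of_mem_block hy⟩
    refine segment_subset_carrier hs ?_
    rcases hend with h | h
    · rw [h]; exact left_mem_segment ℝ _ _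
    · rw [h]; exact right_mem_segment ℝ _ _

/-- THE CROSS HAS EUCLIDEAN LENGTH 2√2. [cite: Balaban1987RG1, p.257 (linear size d_j, edges of cubes)] -/
theorem elen_cross (c : Pt 2) : elen (cross c) = 2 * Real.sqrt 2 := by
  have h1 : edist2 (corner (vtx c ∅)) (corner (vtx c Finset.univ)) = Real.sqrt 2 := by
    unfold edist2
    congr 1
    simp only [Fin.sum_univ_two, corner, vtx, Finset.notMem_empty, if_false, Finset.mem_univ, if_true,
      Int.cast_add, Int.cast_one]
    ring
  have h2 : edist2 (corner (vtx c ({0} : Finset (Fin 2)))) (corner (vtx c ({1} : Finset (Fin 2)))) = Real.sqrt 2 := by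
    unfold edist2
    congr 1
    simp only [Fin.sum_univ_two, corner, vtx, Finset.mem_singleton]
    simp
    ring
  simp only [cross, elen_cons, elen_nil, h1, h2]
  ring

/-- THE EUCLIDEAN SEPARATION ON THE 3 × 3 BLOCK: the cross is an admissible tree graph of Euclidean length 2√2 < 3,
while every admissible EDGE graph for the 3 × 3 block has Euclidean length = its number of unit edges ≥ 3 (§6
`block_two`).  So «there are also the shortest tree graphs formed by edges of cubes» fails for this X under the
Euclidean length too; of the three usual norms only the ℓ¹ reading (there the cross has length 4 and the star of §6
length d·2^{d−1}) is not separated by this file's witnesses — cell GAPS.md G-B12-08. [cite: Balaban1987RG1, p.257 (linear size d_j, edges of cubes)] -/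
theorem euclidean_separation_block_two (c : Pt 2) :
    Admissible (B13ScaleTransfer.block c) (cross c) ∧ elen (cross c) < 3 ∧
      ∀ E, EAdmissible (B13ScaleTransfer.block c) E → (3 : ℝ) ≤ elen (toSegs E) := by
  refine ⟨admissible_cross c, ?_, fun E hE => ?_⟩
  · rw [elen_cross]
    have : Real.sqrt 2 < 3 / 2 := (Real.sqrt_lt' (by norm_num)).2 (by norm_num)
    linarith
  · rw [elen_toSegs hE.lattice]
    exact_mod_cast (block_two c).2.trans (edgeLen_le_nedges hE)

end

end Literature.MathematicalPhysics.QuantumFieldTheory.Balaban1983to89.B12EdgeTreeLength257
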